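import Literature.NumberTheory.Transcendental.TubbsPeriodsIndependenceValues
import Literature.NumberTheory.Transcendental.TubbsPeriodsIndependenceProofs
import Literature.NumberTheory.Transcendental.BWEnvelope
import Literature.NumberTheory.Transcendental.ChudnovskySiegel
import Literature.NumberTheory.Transcendental.GelfondCriterionProofs
import HarnessLib

/-!
# Tubbs 1990, Theorem 4 (periods form) — the main argument and the proof

Topic `Literature/NumberTheory/Transcendental` (trunk T-TRANSCEND). Last layer of the proof of the
named fact `Literature.NumberTheory.Transcendental.Tubbs1990_thm4_periods`
(`TubbsPeriodsIndependence.lean`; R. Tubbs, *Algebraic groups and small transcendence degree, II*,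
J. Number Theory 35 (1990), Thm 4 p. 112 and §5 pp. 124–127):

> for a lattice basis `(ω₁, ω₂)` with invariants `g₂, g₃` and `c ≠ 0`, two of the numbers
> `g₂, g₃, ω₁, ω₂, c, e^{cω₁}, e^{cω₂}` are algebraically independent over `ℚ`.

The theorem `Tubbs.Tubbs1990_thm4_periods_holds` at the end of this file proves the fact along the
printed architecture (zero estimate on the algebraic group). The fact's discharge of record,
`Literature.NumberTheory.Transcendental.Tubbs1990_thm4_periods_holds`, landed in parallel in
`TubbsPeriodsMain.lean` (files `TubbsPeriods{Function,Taylor,Analytic,Values,Construction,Main}.lean`,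
where the zero estimate is replaced by extrapolation plus Tijdeman's lemma); the two developments
share only `TubbsPeriodsIndependenceProofs.lean` and the generic envelope/Siegel/Gel'fond files.

## The argument (Tubbs §5, Gel'fond's method), and where its steps live

Suppose the transcendence degree is `< 2`. WLOG `|e^{cω₂}| ≠ 1`
(`Tubbs1990_thm4_periods_of_norm_exp_ne_one`, `TubbsPeriodsIndependenceProofs.lean`). Then all
seven numbers are algebraic over `ℚ(θ)` for a transcendental `θ` (`exists_theta_of_not_two_le_trdeg`),
hence so are the seven generators `x = (ω₁/2, ω₂, c, e^{cω₁/2}, e^{cω₂}, e₁, g₂/2)` of the value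
polynomials (`Tubbs.isAlgebraic_xv`), and the regular representation of `ℚ(θ)(x)/ℚ(θ)` with
denominators cleared is an `Envelope` (`BrownawellWaldschmidt.exists_envelope`). This is the data
`Tubbs.Setup`; `Tubbs.Setup.core` derives a contradiction from it, at levels `M = 1, 2, …`:

* **parameters** (polynomial room, all exponents of `M`): points `ω₁/2 + n₁ω₁ + n₂ω₂`,
  `n₁, n₂ < 3M⁴`; degrees `D = K₀M⁶` in `z` and in `℘`, `L₁ = K₀M²` in `e^{cz}`
  (`K₀ = 72 C₁ d²`, `d = [ℚ(θ)(x) : ℚ(θ)]`, `C₁ = ⌈C_A⌉ + 1`, `C_A` the constant of Schwarz's lemma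
  `Tubbs.norm_iteratedDeriv_affF_le_of_zeros`); multiplicity `T₀ = 3C₁K₀M⁶` in Siegel's lemma;
  derivatives of order `≤ 3T'`, `T' = ΛM⁶`, `Λ = 64(c_Z + 1)K₀³`, in the zero estimate;
* **Siegel** (`siegel_step`, Tubbs Prop. 5.1 (a)): `Chudnovsky.siegel_poly` over `ℤ[θ]` through the
  envelope (`homEval`), using the value formula `Tubbs.iteratedDeriv_affF` and the degree/height
  bounds of `TubbsPeriodsIndependenceValues.lean`; `#unknowns ≥ 4 #equations` by the choice of `K₀`;
* **zero estimate** (`exists_xi`, Tubbs Cor. 5.2): `Tubbs.exists_iteratedDeriv_auxF_ne_zero`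
  (`TubbsPeriodsIndependenceZeroEst.lean`, the PROVED multiplicity estimate on `𝔾ₘ × E × 𝔾ₐ` with the
  isogeny/torsion trick) gives a point of the grid and an order `t₀ ≤ 3T'` with
  `ξ = F^{(t₀)}(ω₁/2 + y_n) ≠ 0`, all lower derivatives vanishing there;
* **Schwarz** (Tubbs Prop. 5.1 (c)): `|ξ| ≤ e^{O(M⁷)} e^{-27K₀M¹⁴}`
  (`Tubbs.norm_iteratedDeriv_affF_le_of_zeros`, `TubbsPeriodsIndependenceAnalytic.lean`);
* **norm** (`level_struct`, `level`, Tubbs Prop. 5.1 (d)): `Q_M = det(homEval … (Pmix pp t₀ n))`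
  has `Q_M(θ) ≠ 0`, `deg Q_M = O(M⁶)`, `log ‖Q_M‖₁ = O(M⁷)`, `log |Q_M(θ)| ≤ O(M⁷) - 27K₀M¹⁴`
  (all constants explicit, `§ Exponential bookkeeping`);
* **Gel'fond's criterion** (`core`): `gelfond_criterion_not_small_values`
  (`GelfondCriterionProofs.lean`) with `δ_N ≍ M⁶`, `σ_N ≍ M⁷`, `a = 128` contradicts the decay
  `e^{-27K₀M¹⁴}`.

The file follows `BWConstruction.lean`/`BWMain.lean` (Brownawell–Waldschmidt) and
`ChudnovskyMain.lean` declaration by declaration. Everything is PROVED; no named facts are introduced.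

## References

* R. Tubbs, *Algebraic groups and small transcendence degree, II*, J. Number Theory 35 (1990)
  109–127, Thm 4 (p. 112), §5 Prop. 5.1, Cor. 5.2 (pp. 124–127). [Tubbs1990]
* G. V. Chudnovsky, *Contributions to the theory of transcendental numbers*, AMS (1984), Ch. 7 §§2–3
  (the method; tree files `Chudnovsky*.lean`). [Chudnovsky1984]
* A. Baker, *Transcendental Number Theory*, CUP (1975), Ch. 12 §5 (the architecture; tree files
  `BW*.lean`). [BakerTNT1975]
-/

noncomputable section

open Complex MvPolynomial Finset Filter Topology
open scoped PeriodPair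

namespace Literature.NumberTheory.Transcendental

namespace Tubbs

open scoped Polynomial Nat IntermediateField
open Chudnovsky (zl1 l1 wnorm siegel_poly natDegree_det_le_of_entry zl1_det_le_of_entry norm_det_le_of_vecMul
  zl1_le_of_coeff_le norm_aeval_le_zl1 abs_coeff_le_zl1 wnorm_map_le wnorm_sum_le wnorm_mul_le wnorm_C zl1_C
  normRingSeminorm_int_apply zl1_one wnorm_nonneg e₁)
open BrownawellWaldschmidt (homEval evC Envelope exists_envelope natDegree_homEval_entry_le
  seminorm_homEval_entry_le evC_C evC_map_C homEval_sum homEval_C_mul)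

/-! ### The data of the proof by contradiction -/

/-- **The data of the proof by contradiction** of Tubbs 1990, Thm 4 (periods form): a lattice basis
`(ω₁, ω₂)`, `c ≠ 0` with `|e^{cω₂}| ≠ 1` (WLOG, `Tubbs1990_thm4_periods_of_norm_exp_ne_one`), a
transcendental `θ`, and an algebraic envelope over `ℚ(θ)` of the seven numbers
`x = (ω₁/2, ω₂, c, e^{cω₁/2}, e^{cω₂}, e₁, g₂/2)` (this is what "`trdeg ≤ 1`" provides).
[cite: Tubbs1990, §5 p. 124] -/
structure Setup where
  /-- the lattice basis -/
  L : PeriodPair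
  /-- the exponent `c` (`β` in Tubbs's notation, up to the period) -/
  c : ℂ
  hc : c ≠ 0
  hB : ‖cexp (c * L.ω₂)‖ ≠ 1
  /-- the transcendental parameter -/
  θ : ℂ
  hθ : Transcendental ℚ θ
  /-- the envelope of the seven generators over `ℚ(θ)` -/
  E : Envelope θ (xv L c)

namespace Setup

variable (S : Setup)

/-- The degree `d = [K : ℚ(θ)]`. [folklore] -/
def d : ℕ := S.E.d

/-- Auxiliary (`one_le_d`). [folklore] -/
lemma one_le_d : 1 ≤ S.d := S.E.d_pos

/-! ### Envelope bounds -/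

/-- A common degree bound `δ₀` for the envelope data. [folklore] -/
def δ₀ : ℕ := S.E.exists_bounds.choose

/-- A common height bound `H₀ ≥ 1` for the envelope data. [folklore] -/
def H₀ : ℝ := S.E.exists_bounds.choose_spec.choose

/-- Auxiliary (`natDegree_N_le`). [folklore] -/
lemma natDegree_N_le : ∀ l i j, (S.E.N l i j).natDegree ≤ S.δ₀ :=
  S.E.exists_bounds.choose_spec.choose_spec.1

/-- Auxiliary (`natDegree_b_le`). [folklore] -/
lemma natDegree_b_le : S.E.b.natDegree ≤ S.δ₀ :=
  S.E.exists_bounds.choose_spec.choose_spec.2.1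

/-- Auxiliary (`one_le_H₀`). [folklore] -/
lemma one_le_H₀ : 1 ≤ S.H₀ :=
  S.E.exists_bounds.choose_spec.choose_spec.2.2.1

/-- `H₀ ≥ 0`. [folklore] -/
lemma H₀_nonneg : 0 ≤ S.H₀ := le_trans zero_le_one S.one_le_H₀

/-- Auxiliary (`zl1_N_le`). [folklore] -/
lemma zl1_N_le : ∀ l i j, zl1 (S.E.N l i j) ≤ S.H₀ :=
  S.E.exists_bounds.choose_spec.choose_spec.2.2.2.1

/-- Auxiliary (`zl1_b_le`). [folklore] -/
lemma zl1_b_le : zl1 S.E.b ≤ S.H₀ :=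
  S.E.exists_bounds.choose_spec.choose_spec.2.2.2.2

/-! ### The constants -/

/-- **The analytic constant** `C_A` of `norm_iteratedDeriv_affF_le_of_zeros` (Schwarz's lemma for the
auxiliary function on the grid `ω₁/2 + n₁ω₁ + n₂ω₂`). [folklore] -/
def CA : ℝ := (norm_iteratedDeriv_affF_le_of_zeros S.L S.c).choose

/-- `C_A ≥ 0`. [folklore] -/
lemma CA_nonneg : 0 ≤ S.CA := (norm_iteratedDeriv_affF_le_of_zeros S.L S.c).choose_spec.1

/-- The defining property of `C_A`. [folklore] -/
lemma CA_spec : ∀ (D L₁ X T : ℕ), 1 ≤ X → ∀ p : Coeff D L₁ → ℂ,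
    (∀ n₁ n₂ : ℕ, n₁ < X → n₂ < X → ∀ j < T,
      iteratedDeriv j (auxF S.L S.c D L₁ p) (S.L.ω₁ / 2 + latt S.L n₁ n₂) = 0) →
    ∀ n₁ n₂ : ℕ, n₁ < X → n₂ < X → ∀ j : ℕ,
      ‖iteratedDeriv j (affF S.L S.c D L₁ p) (S.L.ω₁ / 2 + latt S.L n₁ n₂)‖ ≤
        ‖p‖ * j.factorial * Real.exp (S.CA * ((D + L₁ + 1) * X ^ 2 + j)) * Real.exp (-(T * X ^ 2 : ℝ)) :=
  (norm_iteratedDeriv_affF_le_of_zeros S.L S.c).choose_spec.2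

/-- `C₁ = ⌈C_A⌉ + 1`, a natural number `≥ C_A + 1`. [folklore] -/
def C1 : ℕ := ⌈S.CA⌉₊ + 1

/-- `C_A + 1 ≤ C₁`. [folklore] -/
lemma CA_add_one_le_C1 : S.CA + 1 ≤ S.C1 := by
  unfold C1; push_cast; linarith [Nat.le_ceil S.CA]

/-- `1 ≤ C₁`. [folklore] -/
lemma one_le_C1 : 1 ≤ S.C1 := Nat.le_add_left _ _

/-- **The scale constant** `K₀ = 72 C₁ d²`: `L₁ = K₀M²`, `D = K₀M⁶` (Siegel's count needs
`L₁ ≥ 72 C₁ d² M²`). [folklore] -/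
def K₀ : ℕ := 72 * S.C1 * S.d ^ 2

/-- `72 ≤ K₀`. [folklore] -/
lemma le_K₀ : 72 ≤ S.K₀ := by
  unfold K₀
  have h1 := S.one_le_C1
  have h2 := S.one_le_d
  calc 72 = 72 * 1 * 1 ^ 2 := by norm_num
    _ ≤ 72 * S.C1 * S.d ^ 2 := by gcongr

/-- `1 ≤ K₀`. [folklore] -/
lemma one_le_K₀ : 1 ≤ S.K₀ := le_trans (by norm_num) S.le_K₀

/-- `C₁ ≤ K₀`. [folklore] -/
lemma C1_le_K₀ : S.C1 ≤ S.K₀ := by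
  unfold K₀
  have h2 := S.one_le_d
  calc S.C1 = 1 * S.C1 * 1 ^ 2 := by ring
    _ ≤ 72 * S.C1 * S.d ^ 2 := by gcongr; norm_num

/-- **The zero-estimate constant** `c_Z` of the group model `𝔾ₘ × E × 𝔾ₐ`
(`Tubbs.exists_iteratedDeriv_auxF_ne_zero`). [folklore] -/
def cZ : ℕ := (model S.L).mainConst

/-- `Λ = 64 (c_Z + 1) K₀³`: the derivatives in the zero estimate are of order `≤ 3T'`, `T' = ΛM⁶`.
[folklore] -/
def Λ : ℕ := 64 * (S.cZ + 1) * S.K₀ ^ 3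

/-- `K₀ ≤ Λ`. [folklore] -/
lemma K₀_le_Λ : S.K₀ ≤ S.Λ := by
  unfold Λ
  have h1 := S.one_le_K₀
  calc S.K₀ = 1 * 1 * (S.K₀ * 1 * 1) := by ring
    _ ≤ 64 * (S.cZ + 1) * (S.K₀ * S.K₀ * S.K₀) := by gcongr <;> omega
    _ = 64 * (S.cZ + 1) * S.K₀ ^ 3 := by ring

/-- `C₁ K₀ ≤ Λ` (so that `T₀ ≤ 3T'`). [folklore] -/
lemma C1_mul_K₀_le_Λ : S.C1 * S.K₀ ≤ S.Λ := by
  unfold Λ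
  have h1 := S.one_le_K₀
  have h2 := S.C1_le_K₀
  calc S.C1 * S.K₀ ≤ S.K₀ * S.K₀ := Nat.mul_le_mul_right _ h2
    _ = 1 * 1 * (S.K₀ * S.K₀ * 1) := by ring
    _ ≤ 64 * (S.cZ + 1) * (S.K₀ * S.K₀ * S.K₀) := by gcongr <;> omega
    _ = 64 * (S.cZ + 1) * S.K₀ ^ 3 := by ring

/-- `1 ≤ Λ`. [folklore] -/
lemma one_le_Λ : 1 ≤ S.Λ := le_trans S.one_le_K₀ S.K₀_le_Λ

/-! ### Parameters at level `M` -/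

section Params

variable (M : ℕ)

/-- `D = K₀ M⁶`: the degree in `z` and in `℘`. [folklore] -/
def D : ℕ := S.K₀ * M ^ 6

/-- `L₁ = K₀ M²`: the degree in `e^{cz}`. [folklore] -/
def L₁ : ℕ := S.K₀ * M ^ 2

/-- `T₀ = 3 C₁ K₀ M⁶`: the multiplicity in Siegel's lemma. [folklore] -/
def T₀ : ℕ := 3 * S.C1 * S.K₀ * M ^ 6

/-- `T' = Λ M⁶`: the derivatives in the zero estimate are of order `≤ 3T'`. [folklore] -/
def T' : ℕ := S.Λ * M ^ 6

/-- `ν = 11 K₀ + 3Λ`: `n = ν M⁶` is the degree budget of the value polynomials. [folklore] -/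
def ν : ℕ := 11 * S.K₀ + 3 * S.Λ

/-- `n = ν M⁶`. [folklore] -/
def n : ℕ := S.ν * M ^ 6

/-- The index set of the unknowns `p_{ijk}`: `i ≤ D`, `j ≤ L₁`, `k ≤ D`. [folklore] -/
abbrev Lam : Type := Coeff (S.D M) (S.L₁ M)

/-- The point `ω₁/2 + n₁ω₁ + n₂ω₂`. [folklore] -/
def zpt (n₁ n₂ : ℕ) : ℂ := S.L.ω₁ / 2 + latt S.L n₁ n₂

/-- The value polynomial at `l = (i, j, k)`. [folklore] -/
def Vl (t n₁ n₂ : ℕ) (l : S.Lam M) : MvPolynomial (Fin 7) ℤ := Wv t n₁ n₂ l.1 l.2.1 l.2.2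

/-- The mixed polynomial `∑_l C(pp_l) · V_{t,n,l} ∈ ℤ[T][a₀, …, a₆]`. [folklore] -/
def Pmix (pp : S.Lam M → ℤ[X]) (t n₁ n₂ : ℕ) : MvPolynomial (Fin 7) ℤ[X] :=
  ∑ l : S.Lam M, MvPolynomial.C (pp l) * MvPolynomial.map (Polynomial.C : ℤ →+* ℤ[X]) (S.Vl M t n₁ n₂ l)

/-- The complex coefficient family `p_l = pp_l(θ)`. [folklore] -/
def pθ (pp : S.Lam M → ℤ[X]) : S.Lam M → ℂ := fun l => Polynomial.aeval S.θ (pp l)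

end Params

/-! ### The value identity and degrees -/

section Values

variable (M : ℕ)

/-- **The value identity**: `evC θ x (Pmix pp t n) = F_p^{(t)}(ω₁/2 + y_n)` for `p = pp(θ)`
(`Tubbs.iteratedDeriv_affF`). [cite: Tubbs1990, §3 Lemma 3.1, §5 Prop. 5.1] -/
theorem evC_Pmix (pp : S.Lam M → ℤ[X]) (t n₁ n₂ : ℕ) :
    evC S.θ (xv S.L S.c) (S.Pmix M pp t n₁ n₂) =
      iteratedDeriv t (affF S.L S.c (S.D M) (S.L₁ M) (S.pθ M pp)) (S.zpt n₁ n₂) := by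
  rw [zpt, iteratedDeriv_affF, Pmix, map_sum]
  refine Finset.sum_congr rfl fun l _ => ?_
  rw [map_mul, evC_C, evC_map_C]
  rfl

/-- The coefficients of `Pmix`. [folklore] -/
theorem coeff_Pmix (pp : S.Lam M → ℤ[X]) (t n₁ n₂ : ℕ) (α : Fin 7 →₀ ℕ) :
    (S.Pmix M pp t n₁ n₂).coeff α = ∑ l, pp l * Polynomial.C ((S.Vl M t n₁ n₂ l).coeff α) := by
  rw [Pmix, MvPolynomial.coeff_sum]
  refine Finset.sum_congr rfl fun l _ => ?_
  rw [MvPolynomial.coeff_C_mul, MvPolynomial.coeff_map]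

/-- Degree of a monomial of `V_{t,n,l}` for `t ≤ 3T'`, `n₁, n₂ < 3M⁴`: `≤ n`. [folklore] -/
theorem degree_le_of_mem_support_Vl {t n₁ n₂ : ℕ} (ht : t ≤ 3 * S.T' M) (hn₁ : n₁ < 3 * M ^ 4)
    (hn₂ : n₂ < 3 * M ^ 4) (l : S.Lam M) {α : Fin 7 →₀ ℕ} (hα : α ∈ (S.Vl M t n₁ n₂ l).support) :
    α.degree ≤ S.n M := by
  have h := degree_le_of_mem_support_Wv t n₁ n₂ l.1 l.2.1 l.2.2 hα
  have hi : (l.1 : ℕ) ≤ S.D M := Nat.lt_succ_iff.mp l.1.2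
  have hj : (l.2.1 : ℕ) ≤ S.L₁ M := Nat.lt_succ_iff.mp l.2.1.2
  have hk : (l.2.2 : ℕ) ≤ S.D M := Nat.lt_succ_iff.mp l.2.2.2
  unfold D at hi hk
  unfold L₁ at hj
  unfold T' at ht
  have h1 : (l.2.1 : ℕ) * (2 * n₁ + n₂ + 1) ≤ S.K₀ * M ^ 2 * (9 * M ^ 4) :=
    Nat.mul_le_mul hj (by omega)
  have e1 : S.K₀ * M ^ 2 * (9 * M ^ 4) = 9 * (S.K₀ * M ^ 6) := by ring
  have e2 : S.n M = 11 * (S.K₀ * M ^ 6) + 3 * (S.Λ * M ^ 6) := by unfold n ν; ring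
  rw [e2]
  rw [e1] at h1
  omega

/-- Monomials of `Pmix pp t n` have degree `≤ n` (`t ≤ 3T'`, `n₁, n₂ < 3M⁴`). [folklore] -/
theorem degree_le_of_mem_support_Pmix (pp : S.Lam M → ℤ[X]) {t n₁ n₂ : ℕ} (ht : t ≤ 3 * S.T' M)
    (hn₁ : n₁ < 3 * M ^ 4) (hn₂ : n₂ < 3 * M ^ 4) {α : Fin 7 →₀ ℕ}
    (hα : α ∈ (S.Pmix M pp t n₁ n₂).support) : α.degree ≤ S.n M := by
  rw [MvPolynomial.mem_support_iff, coeff_Pmix] at hα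
  obtain ⟨l, -, hl⟩ := Finset.exists_ne_zero_of_sum_ne_zero hα
  have hlα : α ∈ (S.Vl M t n₁ n₂ l).support := by
    rw [MvPolynomial.mem_support_iff]
    intro h0
    exact hl (by rw [h0, map_zero, mul_zero])
  exact S.degree_le_of_mem_support_Vl M ht hn₁ hn₂ l hlα

/-- `homEval` of `Pmix` is the corresponding combination. [folklore] -/
theorem homEval_Pmix (pp : S.Lam M → ℤ[X]) (t n₁ n₂ : ℕ) {dd : ℕ}
    (N : Fin 7 → Matrix (Fin dd) (Fin dd) ℤ[X]) (b : ℤ[X]) (m : ℕ) :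
    homEval N b m (S.Pmix M pp t n₁ n₂) =
      ∑ l, pp l • homEval N b m (MvPolynomial.map (Polynomial.C : ℤ →+* ℤ[X]) (S.Vl M t n₁ n₂ l)) := by
  rw [Pmix, homEval_sum]
  refine Finset.sum_congr rfl fun l _ => ?_
  rw [homEval_C_mul]

end Values

/-! ### The bookkeeping constants at level `M` -/

section Bounds

variable (M : ℕ)

/-- `A₀ = n δ₀ + 1`: the bound for the degrees of the unknown polynomials `pp_l ∈ ℤ[T]`. [folklore] -/
def A₀ : ℕ := S.n M * S.δ₀ + 1

/-- The base `B₁ = 7(2D + 3T') + L₁` of the height bound of the value polynomials. [folklore] -/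
def B1 : ℝ := 7 * (2 * (S.D M : ℝ) + 3 * (S.T' M : ℝ)) + (S.L₁ M : ℝ)

/-- The base `B₂ = 9 M⁴ ≥ 2n₁ + n₂ + 2`. [folklore] -/
def B2 : ℝ := 9 * (M : ℝ) ^ 4

/-- The `ℓ¹`-bound for the value polynomials: `B₁^{3T'} B₂^{2D + 3T'}`. [folklore] -/
def l1B : ℝ := S.B1 M ^ (3 * S.T' M) * B2 M ^ (2 * S.D M + 3 * S.T' M)

/-- The bound for the entries of the Siegel system: `l1B · d⁷ (dH₀)^n`. [folklore] -/
def Bsieg : ℝ := S.l1B M * ((S.d : ℝ) ^ 7 * (S.d * S.H₀) ^ S.n M)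

/-- Siegel's bound for the coefficients of the `pp_l`: `#Λ · A₀ · Bsieg`. [folklore] -/
def CfB : ℝ := (Fintype.card (S.Lam M) : ℝ) * S.A₀ M * S.Bsieg M

/-- `1 ≤ B₁` for `M ≥ 1`. [folklore] -/
lemma one_le_B1 (hM : 1 ≤ M) : 1 ≤ S.B1 M := by
  unfold B1 L₁
  have h1 : (1 : ℝ) ≤ (S.K₀ * M ^ 2 : ℕ) := by
    have := S.one_le_K₀
    exact_mod_cast Nat.one_le_iff_ne_zero.mpr (by positivity)
  have h2 : (0 : ℝ) ≤ 7 * (2 * (S.D M : ℝ) + 3 * (S.T' M : ℝ)) := by positivity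
  linarith

/-- `1 ≤ B₂` for `M ≥ 1`. [folklore] -/
lemma one_le_B2 (hM : 1 ≤ M) : 1 ≤ B2 M := by
  unfold B2
  have : (1 : ℝ) ≤ M := by exact_mod_cast hM
  nlinarith [one_le_pow₀ (n := 4) this]

/-- `1 ≤ l1B` for `M ≥ 1`. [folklore] -/
lemma one_le_l1B (hM : 1 ≤ M) : 1 ≤ S.l1B M := by
  unfold l1B
  have h1 := one_le_pow₀ (n := 3 * S.T' M) (S.one_le_B1 M hM)
  have h2 := one_le_pow₀ (n := 2 * S.D M + 3 * S.T' M) (one_le_B2 M hM)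
  nlinarith

/-- `1 ≤ Bsieg` for `M ≥ 1`. [folklore] -/
lemma one_le_Bsieg (hM : 1 ≤ M) : 1 ≤ S.Bsieg M := by
  unfold Bsieg
  have hd : (1 : ℝ) ≤ S.d := by exact_mod_cast S.one_le_d
  have h1 := S.one_le_l1B M hM
  have h2 : (1 : ℝ) ≤ (S.d : ℝ) ^ 7 := one_le_pow₀ hd
  have h3 : (1 : ℝ) ≤ ((S.d : ℝ) * S.H₀) ^ S.n M := one_le_pow₀ (by nlinarith [S.one_le_H₀])
  calc (1 : ℝ) = 1 * (1 * 1) := by ring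
    _ ≤ _ := by gcongr

/-- `0 ≤ CfB`. [folklore] -/
lemma CfB_nonneg (hM : 1 ≤ M) : 0 ≤ S.CfB M := by
  unfold CfB
  have := S.one_le_Bsieg M hM
  positivity

/-- The `ℓ¹`-norm of the value polynomials at level `M`: `≤ l1B` (`t ≤ 3T'`, `n₁, n₂ < 3M⁴`). [folklore] -/
theorem l1_Vl_le (hM : 1 ≤ M) {t n₁ n₂ : ℕ} (ht : t ≤ 3 * S.T' M) (hn₁ : n₁ < 3 * M ^ 4)
    (hn₂ : n₂ < 3 * M ^ 4) (l : S.Lam M) : l1 (S.Vl M t n₁ n₂ l) ≤ S.l1B M := by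
  have h := l1_Wv_le t n₁ n₂ l.1 l.2.1 l.2.2
  refine h.trans ?_
  have hi : (l.1 : ℕ) ≤ S.D M := Nat.lt_succ_iff.mp l.1.2
  have hj : (l.2.1 : ℕ) ≤ S.L₁ M := Nat.lt_succ_iff.mp l.2.1.2
  have hk : (l.2.2 : ℕ) ≤ S.D M := Nat.lt_succ_iff.mp l.2.2.2
  have hi' : ((l.1 : ℕ) : ℝ) ≤ S.D M := by exact_mod_cast hi
  have hj' : ((l.2.1 : ℕ) : ℝ) ≤ S.L₁ M := by exact_mod_cast hj
  have hk' : ((l.2.2 : ℕ) : ℝ) ≤ S.D M := by exact_mod_cast hk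
  have ht' : (t : ℝ) ≤ 3 * S.T' M := by exact_mod_cast ht
  have hn : 2 * (n₁ : ℝ) + n₂ + 2 ≤ B2 M := by
    unfold B2
    have : 2 * n₁ + n₂ + 2 ≤ 9 * M ^ 4 := by omega
    exact_mod_cast this
  have hb1 : 7 * (((l.1 : ℕ) : ℝ) + (l.2.2 : ℕ) + t) + (l.2.1 : ℕ) ≤ S.B1 M := by
    unfold B1; linarith
  have hB1 := S.one_le_B1 M hM
  have hB2 := one_le_B2 M hM
  unfold l1B
  calc (7 * (((l.1 : ℕ) : ℝ) + (l.2.2 : ℕ) + t) + (l.2.1 : ℕ)) ^ t * (2 * (n₁ : ℝ) + n₂ + 2) ^ ((l.1 : ℕ) + l.2.2 + t)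
      ≤ S.B1 M ^ t * B2 M ^ ((l.1 : ℕ) + l.2.2 + t) :=
        mul_le_mul (pow_le_pow_left₀ (by positivity) hb1 t) (pow_le_pow_left₀ (by positivity) hn _)
          (by positivity) (by positivity)
    _ ≤ S.B1 M ^ (3 * S.T' M) * B2 M ^ (2 * S.D M + 3 * S.T' M) :=
        mul_le_mul (pow_le_pow_right₀ hB1 ht) (pow_le_pow_right₀ hB2 (by omega)) (by positivity)
          (by positivity)

end Bounds

/-! ### Siegel's step -/

section Siegel

variable (M : ℕ)

/-- `T₀ ≤ 3T'`. [folklore] -/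
lemma T₀_le : S.T₀ M ≤ 3 * S.T' M := by
  unfold T₀ T'
  have h := S.C1_mul_K₀_le_Λ
  calc 3 * S.C1 * S.K₀ * M ^ 6 = 3 * ((S.C1 * S.K₀) * M ^ 6) := by ring
    _ ≤ 3 * (S.Λ * M ^ 6) := by gcongr

/-- Degrees of the entries of the Siegel system: `≤ n δ₀`. [folklore] -/
theorem natDegree_homEval_Vl_le {t n₁ n₂ : ℕ} (ht : t ≤ 3 * S.T' M) (hn₁ : n₁ < 3 * M ^ 4)
    (hn₂ : n₂ < 3 * M ^ 4) (l : S.Lam M) (i₁ i₂ : Fin S.E.d) :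
    (homEval S.E.N S.E.b (S.n M) (MvPolynomial.map (Polynomial.C : ℤ →+* ℤ[X])
      (S.Vl M t n₁ n₂ l)) i₁ i₂).natDegree ≤ S.n M * S.δ₀ := by
  have h := natDegree_homEval_entry_le (δP := 0)
    (P := MvPolynomial.map (Polynomial.C : ℤ →+* ℤ[X]) (S.Vl M t n₁ n₂ l)) S.natDegree_N_le
    S.natDegree_b_le
    (fun α hα => S.degree_le_of_mem_support_Vl M ht hn₁ hn₂ l (support_map_subset _ _ hα))
    (fun α => by rw [MvPolynomial.coeff_map, Polynomial.natDegree_C]) i₁ i₂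
  simpa using h

/-- Heights of the entries of the Siegel system: `zl1 ≤ Bsieg`. [folklore] -/
theorem zl1_homEval_Vl_le (hM : 1 ≤ M) {t n₁ n₂ : ℕ} (ht : t ≤ 3 * S.T' M) (hn₁ : n₁ < 3 * M ^ 4)
    (hn₂ : n₂ < 3 * M ^ 4) (l : S.Lam M) (i₁ i₂ : Fin S.E.d) :
    zl1 (homEval S.E.N S.E.b (S.n M) (MvPolynomial.map (Polynomial.C : ℤ →+* ℤ[X])
      (S.Vl M t n₁ n₂ l)) i₁ i₂) ≤ S.Bsieg M := by
  have h := seminorm_homEval_entry_le zl1 zl1_one.le S.one_le_H₀ S.zl1_N_le S.zl1_b_le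
    (P := MvPolynomial.map (Polynomial.C : ℤ →+* ℤ[X]) (S.Vl M t n₁ n₂ l))
    (fun α hα => S.degree_le_of_mem_support_Vl M ht hn₁ hn₂ l (support_map_subset _ _ hα)) i₁ i₂
  refine h.trans ?_
  unfold Bsieg
  have hw : wnorm zl1 (MvPolynomial.map (Polynomial.C : ℤ →+* ℤ[X]) (S.Vl M t n₁ n₂ l)) ≤ S.l1B M :=
    (wnorm_map_le _ _ _ (fun z => by rw [zl1_C, normRingSeminorm_int_apply]) _).trans
      (S.l1_Vl_le M hM ht hn₁ hn₂ l)
  have hH := S.H₀_nonneg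
  exact mul_le_mul_of_nonneg_right hw (by positivity)

/-- **Siegel's count**: `2 · #equations · (A₀ + nδ₀) ≤ #unknowns · A₀` with `L₁ = K₀M²`, `D = K₀M⁶`,
`T₀ = 3C₁K₀M⁶`, `K₀ = 72 C₁ d²`. [folklore] -/
lemma siegel_count (C1 d M A nd : ℕ) (hC : 1 ≤ C1) (hd : 1 ≤ d) (hA : A = nd + 1) :
    2 * (3 * C1 * (72 * C1 * d ^ 2) * M ^ 6 * (3 * M ^ 4 * (3 * M ^ 4)) * (d * d) * (A + nd)) ≤
      (72 * C1 * d ^ 2 * M ^ 6 + 1) * ((72 * C1 * d ^ 2 * M ^ 2 + 1) * (72 * C1 * d ^ 2 * M ^ 6 + 1)) * A := by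
  set K := 72 * C1 * d ^ 2 with hK
  have hK2 : 2 ≤ K := by
    rw [hK]
    calc 2 ≤ 72 * 1 * 1 ^ 2 := by norm_num
      _ ≤ 72 * C1 * d ^ 2 := by gcongr
  have h1 : 2 * (3 * C1 * K * M ^ 6 * (3 * M ^ 4 * (3 * M ^ 4)) * (d * d) * (A + nd)) ≤
      108 * C1 * d ^ 2 * K * M ^ 14 * A := by
    have : A + nd ≤ 2 * A := by omega
    calc 2 * (3 * C1 * K * M ^ 6 * (3 * M ^ 4 * (3 * M ^ 4)) * (d * d) * (A + nd))
        ≤ 2 * (3 * C1 * K * M ^ 6 * (3 * M ^ 4 * (3 * M ^ 4)) * (d * d) * (2 * A)) := by gcongr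
      _ = 108 * C1 * d ^ 2 * K * M ^ 14 * A := by ring
  have h2 : K ^ 3 * M ^ 14 * A ≤ (K * M ^ 6 + 1) * ((K * M ^ 2 + 1) * (K * M ^ 6 + 1)) * A := by
    refine Nat.mul_le_mul_right _ ?_
    calc K ^ 3 * M ^ 14 = (K * M ^ 6) * ((K * M ^ 2) * (K * M ^ 6)) := by ring
      _ ≤ (K * M ^ 6 + 1) * ((K * M ^ 2 + 1) * (K * M ^ 6 + 1)) := by gcongr <;> omega
  have h3 : 108 * C1 * d ^ 2 * K ≤ K ^ 3 := by
    calc 108 * C1 * d ^ 2 * K ≤ 144 * C1 * d ^ 2 * K := by gcongr; norm_num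
      _ = 2 * K * K := by rw [hK]; ring
      _ ≤ K * K * K := by gcongr
      _ = K ^ 3 := by ring
  calc _ ≤ 108 * C1 * d ^ 2 * K * M ^ 14 * A := h1
    _ ≤ K ^ 3 * M ^ 14 * A := by gcongr
    _ ≤ _ := h2

/-- **Siegel's step** (Tubbs §5, Prop. 5.1 (a), p. 125: Siegel's lemma with coefficients in `ℤ[θ]`):
there are `pp_l ∈ ℤ[T]`, not all zero, of degree `< A₀` and coefficients `≤ CfB`, such that the
representing matrices of the mixed polynomials vanish for all `t < T₀` and all points of the grid
(`M ≥ 1`). [cite: Tubbs1990, §5 Prop. 5.1 (p. 125)] -/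
theorem siegel_step (hM : 1 ≤ M) :
    ∃ pp : S.Lam M → ℤ[X], pp ≠ 0 ∧ (∀ l, (pp l).natDegree < S.A₀ M) ∧
      (∀ l k, |((pp l).coeff k : ℝ)| ≤ S.CfB M) ∧
      ∀ t < S.T₀ M, ∀ n₁ n₂ : ℕ, n₁ < 3 * M ^ 4 → n₂ < 3 * M ^ 4 →
        homEval S.E.N S.E.b (S.n M) (S.Pmix M pp t n₁ n₂) = 0 := by
  classical
  have hd1 := S.one_le_d
  -- the system
  let ι := (Fin (S.T₀ M) × (Fin (3 * M ^ 4) × Fin (3 * M ^ 4))) × (Fin S.E.d × Fin S.E.d)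
  let W : ι → S.Lam M → ℤ[X] := fun e l =>
    homEval S.E.N S.E.b (S.n M) (MvPolynomial.map (Polynomial.C : ℤ →+* ℤ[X])
      (S.Vl M e.1.1 e.1.2.1 e.1.2.2 l)) e.2.1 e.2.2
  have ht : ∀ e : ι, (e.1.1 : ℕ) ≤ 3 * S.T' M := fun e => e.1.1.2.le.trans (S.T₀_le M)
  have hn₁ : ∀ e : ι, (e.1.2.1 : ℕ) < 3 * M ^ 4 := fun e => e.1.2.1.2
  have hn₂ : ∀ e : ι, (e.1.2.2 : ℕ) < 3 * M ^ 4 := fun e => e.1.2.2.2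
  have hWδ : ∀ e l, (W e l).natDegree ≤ S.n M * S.δ₀ := fun e l =>
    S.natDegree_homEval_Vl_le M (ht e) (hn₁ e) (hn₂ e) l _ _
  have hWB : ∀ e l k, |((W e l).coeff k : ℝ)| ≤ S.Bsieg M := fun e l k =>
    (abs_coeff_le_zl1 _ _).trans (S.zl1_homEval_Vl_le M hM (ht e) (hn₁ e) (hn₂ e) l _ _)
  have hι : 0 < Fintype.card ι := by
    simp only [ι, Fintype.card_prod, Fintype.card_fin]
    unfold T₀
    have : 0 < S.E.d := S.E.d_pos
    have : 0 < M := hM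
    have := S.one_le_C1
    have := S.one_le_K₀
    positivity
  have hA : 0 < S.A₀ M := Nat.succ_pos _
  have hcard : 2 * (Fintype.card ι * (S.A₀ M + S.n M * S.δ₀)) ≤
      Fintype.card (S.Lam M) * S.A₀ M := by
    simp only [ι, Fintype.card_prod, Fintype.card_fin]
    have hE : S.E.d = S.d := rfl
    rw [hE]
    have h := siegel_count S.C1 S.d M (S.A₀ M) (S.n M * S.δ₀) S.one_le_C1 S.one_le_d rfl
    unfold T₀ D L₁ K₀
    exact h
  obtain ⟨pp, hpp0, hppdeg, hppB, hppeq⟩ :=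
    siegel_poly W (S.n M * S.δ₀) (S.A₀ M) (S.Bsieg M) hWδ hWB (S.one_le_Bsieg M hM) hι hA hcard
  refine ⟨pp, hpp0, hppdeg, fun l k => (hppB l k).trans (le_of_eq (by unfold CfB; ring)), ?_⟩
  intro t htT n₁ n₂ hn₁' hn₂'
  refine Matrix.ext fun i₁ i₂ => ?_
  have h := hppeq ((⟨t, htT⟩, (⟨n₁, hn₁'⟩, ⟨n₂, hn₂'⟩)), (i₁, i₂))
  rw [homEval_Pmix, Matrix.sum_apply]
  simpa [W, Matrix.smul_apply] using h

/-- The vanishing of the representing matrix forces `F_p^{(t)}(ω₁/2 + y_n) = 0`. [folklore] -/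
theorem iteratedDeriv_affF_eq_zero (pp : S.Lam M → ℤ[X]) {t n₁ n₂ : ℕ} (ht : t ≤ 3 * S.T' M)
    (hn₁ : n₁ < 3 * M ^ 4) (hn₂ : n₂ < 3 * M ^ 4)
    (h0 : homEval S.E.N S.E.b (S.n M) (S.Pmix M pp t n₁ n₂) = 0) :
    iteratedDeriv t (affF S.L S.c (S.D M) (S.L₁ M) (S.pθ M pp)) (S.zpt n₁ n₂) = 0 := by
  have h := S.E.evC_eq_zero_of_homEval_eq_zero
    (fun α hα => S.degree_le_of_mem_support_Pmix M pp ht hn₁ hn₂ hα) h0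
  rwa [evC_Pmix] at h

end Siegel

/-! ### The zero estimate and Schwarz's lemma applied -/

section Zero

variable (M : ℕ)

/-- A transcendental number is not a root of a nonzero integer polynomial. [folklore] -/
theorem aeval_theta_ne_zero {q : ℤ[X]} (hq : q ≠ 0) : Polynomial.aeval S.θ q ≠ 0 := by
  intro h
  apply S.hθ
  refine ⟨q.map (algebraMap ℤ ℚ), ?_, ?_⟩
  · exact (Polynomial.map_ne_zero_iff (algebraMap ℤ ℚ).injective_int).mpr hq
  · rwa [Polynomial.aeval_map_algebraMap]

/-- `p = pp(θ) ≠ 0` for `pp ≠ 0`. [folklore] -/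
theorem pθ_ne_zero {pp : S.Lam M → ℤ[X]} (hpp : pp ≠ 0) : S.pθ M pp ≠ 0 := by
  obtain ⟨l, hl⟩ := Function.ne_iff.mp hpp
  exact Function.ne_iff.mpr ⟨l, S.aeval_theta_ne_zero hl⟩

/-- `1 ≤ D` for `M ≥ 1`. [folklore] -/
lemma one_le_D (hM : 1 ≤ M) : 1 ≤ S.D M := by
  unfold D
  have := S.one_le_K₀
  exact Nat.one_le_iff_ne_zero.mpr (by positivity)

/-- The first numerical hypothesis of the zero estimate: `c_Z (4D)³ < (T'+1) · m X²`. [folklore] -/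
lemma zeroEst_h1 (hM : 1 ≤ M) :
    (model S.L).mainConst * (4 * S.D M) ^ 3 < (S.T' M + 1) * (M ^ 4 * (M ^ 4) ^ 2) := by
  change S.cZ * (4 * S.D M) ^ 3 < (S.T' M + 1) * (M ^ 4 * (M ^ 4) ^ 2)
  unfold D T' Λ
  have hM' : 0 < M := hM
  calc S.cZ * (4 * (S.K₀ * M ^ 6)) ^ 3 = 64 * S.cZ * S.K₀ ^ 3 * M ^ 18 := by ring
    _ < 64 * S.cZ * S.K₀ ^ 3 * M ^ 18 + M ^ 12 := Nat.lt_add_of_pos_right (by positivity)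
    _ ≤ 64 * (S.cZ + 1) * S.K₀ ^ 3 * M ^ 18 + M ^ 12 := by gcongr; omega
    _ = (64 * (S.cZ + 1) * S.K₀ ^ 3 * M ^ 6 + 1) * (M ^ 4 * (M ^ 4) ^ 2) := by ring

/-- An auxiliary comparison: `16 c_Z K₀² M¹² < (ΛM⁶ + 1) M⁸`. [folklore] -/
lemma zeroEst_aux (hM : 1 ≤ M) :
    S.cZ * (4 * (S.K₀ * M ^ 6)) ^ 2 < (S.Λ * M ^ 6 + 1) * M ^ 8 := by
  unfold Λ
  have hM' : 0 < M := hM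
  have hK := S.one_le_K₀
  calc S.cZ * (4 * (S.K₀ * M ^ 6)) ^ 2 = 16 * S.cZ * (S.K₀ ^ 2 * 1) * (M ^ 12 * 1) := by ring
    _ ≤ 64 * (S.cZ + 1) * (S.K₀ ^ 2 * S.K₀) * (M ^ 12 * M ^ 2) := by
        gcongr
        · norm_num
        · omega
        · exact Nat.one_le_pow _ _ hM'
    _ < 64 * (S.cZ + 1) * (S.K₀ ^ 2 * S.K₀) * (M ^ 12 * M ^ 2) + M ^ 8 :=
        Nat.lt_add_of_pos_right (by positivity)
    _ = (64 * (S.cZ + 1) * S.K₀ ^ 3 * M ^ 6 + 1) * M ^ 8 := by ring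

/-- The second numerical hypothesis: `c_Z (4D)² < (T'+1) · m X`. [folklore] -/
lemma zeroEst_h2 (hM : 1 ≤ M) :
    (model S.L).mainConst * (4 * S.D M) ^ 2 < (S.T' M + 1) * (M ^ 4 * M ^ 4) := by
  change S.cZ * (4 * S.D M) ^ 2 < (S.T' M + 1) * (M ^ 4 * M ^ 4)
  unfold D T'
  have h := S.zeroEst_aux M hM
  have e : M ^ 4 * M ^ 4 = M ^ 8 := by ring
  rwa [e]

/-- The third numerical hypothesis: `c_Z (4D)² < (T'+1) · X²`. [folklore] -/
lemma zeroEst_h3 (hM : 1 ≤ M) :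
    (model S.L).mainConst * (4 * S.D M) ^ 2 < (S.T' M + 1) * (M ^ 4) ^ 2 := by
  change S.cZ * (4 * S.D M) ^ 2 < (S.T' M + 1) * (M ^ 4) ^ 2
  unfold D T'
  have h := S.zeroEst_aux M hM
  have e : (M ^ 4) ^ 2 = M ^ 8 := by ring
  rwa [e]

/-- The fourth numerical hypothesis: `c_Z (4D) < T'+1`. [folklore] -/
lemma zeroEst_h5 : (model S.L).mainConst * (4 * S.D M) < S.T' M + 1 := by
  change S.cZ * (4 * S.D M) < S.T' M + 1
  unfold D T' Λ
  have hK := S.one_le_K₀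
  refine Nat.lt_succ_of_le ?_
  calc S.cZ * (4 * (S.K₀ * M ^ 6)) = 4 * S.cZ * (S.K₀ * 1 * 1) * M ^ 6 := by ring
    _ ≤ 64 * (S.cZ + 1) * (S.K₀ * S.K₀ * S.K₀) * M ^ 6 := by gcongr <;> omega
    _ = 64 * (S.cZ + 1) * S.K₀ ^ 3 * M ^ 6 := by ring

/-- **The zero estimate and Schwarz's lemma applied** (Tubbs §5, Prop. 5.1 (b)–(c), pp. 125–126,
with Cor. 5.2): if `pp ≠ 0` and all `F_p^{(t)}(ω₁/2 + y_n)`, `t < T₀`, `n₁, n₂ < 3M⁴`, vanish, then at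
some point of the grid the first non-vanishing derivative `ξ = F_p^{(t₀)}(ω₁/2 + y_n) ≠ 0` has
`t₀ ≤ 3T'` and `|ξ| ≤ ‖p‖ t₀! e^{C_A((D+L₁+1)(3M⁴)² + t₀)} e^{-T₀ (3M⁴)²}`.
[cite: Tubbs1990, §5 Prop. 5.1, Cor. 5.2 (pp. 125–126)] -/
theorem exists_xi (hM : 1 ≤ M) {pp : S.Lam M → ℤ[X]} (hpp : pp ≠ 0)
    (hvan : ∀ t < S.T₀ M, ∀ n₁ n₂ : ℕ, n₁ < 3 * M ^ 4 → n₂ < 3 * M ^ 4 →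
      iteratedDeriv t (affF S.L S.c (S.D M) (S.L₁ M) (S.pθ M pp)) (S.zpt n₁ n₂) = 0) :
    ∃ n₁ n₂ t₀ : ℕ, n₁ < 3 * M ^ 4 ∧ n₂ < 3 * M ^ 4 ∧ t₀ ≤ 3 * S.T' M ∧
      iteratedDeriv t₀ (affF S.L S.c (S.D M) (S.L₁ M) (S.pθ M pp)) (S.zpt n₁ n₂) ≠ 0 ∧
      ‖iteratedDeriv t₀ (affF S.L S.c (S.D M) (S.L₁ M) (S.pθ M pp)) (S.zpt n₁ n₂)‖ ≤
        ‖S.pθ M pp‖ * t₀.factorial *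
          Real.exp (S.CA * ((S.D M + S.L₁ M + 1) * (3 * M ^ 4 : ℕ) ^ 2 + t₀)) *
          Real.exp (-(S.T₀ M * (3 * M ^ 4 : ℕ) ^ 2 : ℝ)) := by
  classical
  set p := S.pθ M pp with hp
  have hp0 : p ≠ 0 := S.pθ_ne_zero M hpp
  -- zeros of `auxF` of order `T₀` on the grid
  have hzA : ∀ n₁ n₂ : ℕ, n₁ < 3 * M ^ 4 → n₂ < 3 * M ^ 4 → ∀ j < S.T₀ M,
      iteratedDeriv j (auxF S.L S.c (S.D M) (S.L₁ M) p) (S.L.ω₁ / 2 + latt S.L n₁ n₂) = 0 := by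
    intro n₁ n₂ hn₁ hn₂
    exact (forall_iteratedDeriv_auxF_eq_zero_iff S.L S.c p (halfPeriod_add_latt_notMem S.L n₁ n₂)
      (S.T₀ M)).mpr fun k hk => hvan k hk n₁ n₂ hn₁ hn₂
  -- the zero estimate
  obtain ⟨n₁, n₂, k, hn₁, hn₂, hk, hne⟩ := exists_iteratedDeriv_auxF_ne_zero S.L S.hc S.hB
    (D := S.D M) (L₁ := S.L₁ M) (m := M ^ 4) (X := M ^ 4) (T' := S.T' M)
    (Nat.one_le_pow _ _ hM) (le_of_eq (by unfold L₁ D; ring)) (Nat.one_le_pow _ _ hM)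
    (S.one_le_D M hM) hp0 (S.zeroEst_h1 M hM) (S.zeroEst_h2 M hM) (S.zeroEst_h3 M hM)
    (S.zeroEst_h5 M)
  -- the first non-vanishing derivative of `auxF` at that point
  have hex : ∃ j, iteratedDeriv j (auxF S.L S.c (S.D M) (S.L₁ M) p) (S.L.ω₁ / 2 + latt S.L n₁ n₂) ≠ 0 :=
    ⟨k, hne⟩
  have ht₀spec := Nat.find_spec hex
  have ht₀k : Nat.find hex ≤ k := Nat.find_min' hex hne
  have hvan_aux : ∀ j < Nat.find hex,
      iteratedDeriv j (auxF S.L S.c (S.D M) (S.L₁ M) p) (S.L.ω₁ / 2 + latt S.L n₁ n₂) = 0 := by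
    intro j hj
    by_contra h
    exact Nat.find_min hex hj h
  have hz := halfPeriod_add_latt_notMem S.L n₁ n₂
  have hvan_aff : ∀ j < Nat.find hex,
      iteratedDeriv j (affF S.L S.c (S.D M) (S.L₁ M) p) (S.L.ω₁ / 2 + latt S.L n₁ n₂) = 0 :=
    (forall_iteratedDeriv_auxF_eq_zero_iff S.L S.c p hz (Nat.find hex)).mp hvan_aux
  have hξ : iteratedDeriv (Nat.find hex) (affF S.L S.c (S.D M) (S.L₁ M) p) (S.L.ω₁ / 2 + latt S.L n₁ n₂) ≠ 0 := by
    intro h0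
    apply ht₀spec
    rw [iteratedDeriv_auxF_eq_of_vanishing S.L S.c p hz hvan_aff, h0, mul_zero]
  have h3X : 1 ≤ 3 * M ^ 4 := by
    have := Nat.one_le_pow 4 M hM
    omega
  have hbound := S.CA_spec (S.D M) (S.L₁ M) (3 * M ^ 4) (S.T₀ M) h3X p hzA n₁ n₂ hn₁ hn₂ (Nat.find hex)
  exact ⟨n₁, n₂, Nat.find hex, hn₁, hn₂, by omega, hξ, hbound⟩

end Zero

/-! ### The norm polynomial -/

section Norm

variable (M : ℕ) (pp : S.Lam M → ℤ[X]) (t₀ n₁ n₂ : ℕ)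

/-- `Q(θ) ≠ 0` as soon as `F_p^{(t₀)}(ω₁/2 + y_n) ≠ 0` (the norm of a nonzero element). [folklore] -/
theorem aeval_det_ne_zero (ht : t₀ ≤ 3 * S.T' M) (hn₁ : n₁ < 3 * M ^ 4) (hn₂ : n₂ < 3 * M ^ 4)
    (hξ : iteratedDeriv t₀ (affF S.L S.c (S.D M) (S.L₁ M) (S.pθ M pp)) (S.zpt n₁ n₂) ≠ 0) :
    Polynomial.aeval S.θ (homEval S.E.N S.E.b (S.n M) (S.Pmix M pp t₀ n₁ n₂)).det ≠ 0 := by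
  refine S.E.det_ne (S.n M) _ (fun α hα => S.degree_le_of_mem_support_Pmix M pp ht hn₁ hn₂ hα) ?_
  rw [evC_Pmix]
  exact hξ

/-- Degrees of the coefficients of `Pmix`: `≤ max deg pp_l`. [folklore] -/
theorem natDegree_coeff_Pmix_le {A : ℕ} (hdeg : ∀ l, (pp l).natDegree < A) (α : Fin 7 →₀ ℕ) :
    ((S.Pmix M pp t₀ n₁ n₂).coeff α).natDegree ≤ A := by
  rw [coeff_Pmix]
  refine Polynomial.natDegree_sum_le_of_forall_le _ _ fun l _ => ?_
  refine Polynomial.natDegree_mul_le.trans ?_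
  rw [Polynomial.natDegree_C, add_zero]
  exact (hdeg l).le

/-- Height of `Pmix`: `wnorm ≤ ∑_l zl1(pp_l) · l1(V_l)`. [folklore] -/
theorem wnorm_Pmix_le :
    wnorm zl1 (S.Pmix M pp t₀ n₁ n₂) ≤ ∑ l, zl1 (pp l) * l1 (S.Vl M t₀ n₁ n₂ l) := by
  unfold Pmix
  refine (wnorm_sum_le _ _ _).trans (Finset.sum_le_sum fun l _ => ?_)
  refine (wnorm_mul_le _ _ _).trans ?_
  rw [wnorm_C]
  refine mul_le_mul_of_nonneg_left ?_ (apply_nonneg _ _)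
  exact wnorm_map_le _ _ _ (fun z => by rw [zl1_C, normRingSeminorm_int_apply]) _

/-- **Degree of `Q`**: `≤ d (A + n δ₀)`. [folklore] -/
theorem natDegree_det_le {A : ℕ} (hdeg : ∀ l, (pp l).natDegree < A) (ht : t₀ ≤ 3 * S.T' M)
    (hn₁ : n₁ < 3 * M ^ 4) (hn₂ : n₂ < 3 * M ^ 4) :
    (homEval S.E.N S.E.b (S.n M) (S.Pmix M pp t₀ n₁ n₂)).det.natDegree ≤
      S.E.d * (A + S.n M * S.δ₀) :=
  natDegree_det_le_of_entry fun i j => natDegree_homEval_entry_le S.natDegree_N_le S.natDegree_b_le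
    (fun _ hα => S.degree_le_of_mem_support_Pmix M pp ht hn₁ hn₂ hα)
    (S.natDegree_coeff_Pmix_le M pp t₀ n₁ n₂ hdeg) i j

/-- **Entries of `Y = homEval N b n (Pmix pp t₀ n)`**: `zl1 ≤ #Λ (A C_f) l1B · d⁷ (dH₀)^n`
(`deg pp_l < A`, `|coeff pp_l| ≤ C_f`). [folklore] -/
theorem zl1_entry_le (hM : 1 ≤ M) {A : ℕ} {Cf : ℝ} (hCf : 0 ≤ Cf) (hdeg : ∀ l, (pp l).natDegree < A)
    (hcoeff : ∀ l k, |((pp l).coeff k : ℝ)| ≤ Cf) (ht : t₀ ≤ 3 * S.T' M)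
    (hn₁ : n₁ < 3 * M ^ 4) (hn₂ : n₂ < 3 * M ^ 4) (i j : Fin S.E.d) :
    zl1 (homEval S.E.N S.E.b (S.n M) (S.Pmix M pp t₀ n₁ n₂) i j) ≤
      (Fintype.card (S.Lam M) : ℝ) * (A * Cf) * S.l1B M *
        ((S.d : ℝ) ^ 7 * (S.d * S.H₀) ^ S.n M) := by
  have hsupp : ∀ α ∈ (S.Pmix M pp t₀ n₁ n₂).support, α.degree ≤ S.n M := fun α hα =>
    S.degree_le_of_mem_support_Pmix M pp ht hn₁ hn₂ hα
  refine (seminorm_homEval_entry_le zl1 zl1_one.le S.one_le_H₀ S.zl1_N_le S.zl1_b_le hsupp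
    i j).trans ?_
  have hH := S.H₀_nonneg
  refine mul_le_mul_of_nonneg_right ?_ (by positivity)
  refine (S.wnorm_Pmix_le M pp t₀ n₁ n₂).trans ?_
  have hterm : ∀ l : S.Lam M, zl1 (pp l) * l1 (S.Vl M t₀ n₁ n₂ l) ≤ (A * Cf) * S.l1B M := by
    intro l
    have h1 : zl1 (pp l) ≤ A * Cf := by
      refine (zl1_le_of_coeff_le _ (hcoeff l)).trans ?_
      gcongr
      exact_mod_cast hdeg l
    exact mul_le_mul h1 (S.l1_Vl_le M hM ht hn₁ hn₂ l) (wnorm_nonneg _ _) (by positivity)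
  calc ∑ l, zl1 (pp l) * l1 (S.Vl M t₀ n₁ n₂ l) ≤ ∑ _l : S.Lam M, (A * Cf) * S.l1B M :=
        Finset.sum_le_sum fun l _ => hterm l
    _ = (Fintype.card (S.Lam M) : ℝ) * (A * Cf) * S.l1B M := by
        rw [Finset.sum_const, Finset.card_univ, nsmul_eq_mul]; ring

/-- **The lower-bound side**: `|Q(θ)| ≤ |b(θ)^n ξ| · d (1 + d R)^d`, `R` bounding the entries of
`Y(θ)`. [cite: Tubbs1990, §5 Prop. 5.1 (d) (p. 126)] -/
theorem norm_aeval_det_le {HY : ℝ} {δY : ℕ} (hHY : 0 ≤ HY)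
    (hY : ∀ i j, zl1 (homEval S.E.N S.E.b (S.n M) (S.Pmix M pp t₀ n₁ n₂) i j) ≤ HY)
    (hYδ : ∀ i j, (homEval S.E.N S.E.b (S.n M) (S.Pmix M pp t₀ n₁ n₂) i j).natDegree ≤ δY)
    (ht : t₀ ≤ 3 * S.T' M) (hn₁ : n₁ < 3 * M ^ 4) (hn₂ : n₂ < 3 * M ^ 4) :
    ‖Polynomial.aeval S.θ (homEval S.E.N S.E.b (S.n M) (S.Pmix M pp t₀ n₁ n₂)).det‖ ≤
      ‖Polynomial.aeval S.θ S.E.b ^ S.n M *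
          iteratedDeriv t₀ (affF S.L S.c (S.D M) (S.L₁ M) (S.pθ M pp)) (S.zpt n₁ n₂)‖ *
        (S.E.d * (1 + S.E.d * (HY * max 1 ‖S.θ‖ ^ δY)) ^ S.E.d) := by
  set Y := homEval S.E.N S.E.b (S.n M) (S.Pmix M pp t₀ n₁ n₂) with hYdef
  have hsupp : ∀ α ∈ (S.Pmix M pp t₀ n₁ n₂).support, α.degree ≤ S.n M := fun α hα =>
    S.degree_le_of_mem_support_Pmix M pp ht hn₁ hn₂ hα
  have heig := S.E.vecMul_homEval hsupp
  rw [S.evC_Pmix M pp t₀ n₁ n₂] at heig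
  have hmap : Polynomial.aeval S.θ Y.det = (Y.map (Polynomial.aeval S.θ : ℤ[X] →ₐ[ℤ] ℂ)).det := by
    rw [show (Polynomial.aeval S.θ : ℤ[X] →ₐ[ℤ] ℂ) Y.det =
      (Polynomial.aeval S.θ : ℤ[X] →ₐ[ℤ] ℂ).toRingHom Y.det from rfl, RingHom.map_det]
    rfl
  rw [hmap]
  refine norm_det_le_of_vecMul _ S.E.β_ne heig fun i j => ?_
  rw [Matrix.map_apply]
  refine (norm_aeval_le_zl1 (Y i j) S.θ).trans ?_
  exact mul_le_mul (hY i j) (pow_le_pow_right₀ (le_max_left _ _) (hYδ i j)) (by positivity) hHY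

end Norm

/-! ### The level-`M` construction assembled -/

section Level

variable (M : ℕ)

/-- The bound `C_p = A₀ · CfB · max(1,|θ|)^{A₀}` for the coefficients `p_l = pp_l(θ)`. [folklore] -/
def Cp : ℝ := S.A₀ M * S.CfB M * max 1 ‖S.θ‖ ^ S.A₀ M

/-- The bound `H_Y = #Λ (A₀ CfB) l1B d⁷(dH₀)^n` for the entries of the representing matrix. [folklore] -/
def HY : ℝ :=
  (Fintype.card (S.Lam M) : ℝ) * (S.A₀ M * S.CfB M) * S.l1B M * ((S.d : ℝ) ^ 7 * (S.d * S.H₀) ^ S.n M)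

/-- The bound for `|ξ|`: `C_p · (3T')! · e^{C_A((D+L₁+1)(3M⁴)² + 3T')} · e^{-T₀(3M⁴)²}`. [folklore] -/
def ξB : ℝ :=
  S.Cp M * (3 * S.T' M).factorial *
    Real.exp (S.CA * ((S.D M + S.L₁ M + 1) * (3 * M ^ 4 : ℕ) ^ 2 + (3 * S.T' M : ℕ))) *
    Real.exp (-(S.T₀ M * (3 * M ^ 4 : ℕ) ^ 2 : ℝ))

/-- The bound for `|Q(θ)|` at level `M`: `|b(θ)|^n · ξB · d (1 + d H_Y max(1,|θ|)^{A₀ + nδ₀})^d`.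
[folklore] -/
def valB : ℝ :=
  ‖Polynomial.aeval S.θ S.E.b‖ ^ S.n M * S.ξB M *
    (S.d * (1 + S.d * (S.HY M * max 1 ‖S.θ‖ ^ (S.A₀ M + S.n M * S.δ₀))) ^ S.d)

/-- `0 ≤ HY`. [folklore] -/
lemma HY_nonneg (hM : 1 ≤ M) : 0 ≤ S.HY M := by
  unfold HY
  have h1 := S.CfB_nonneg M hM
  have h2 := S.one_le_l1B M hM
  have hH := S.H₀_nonneg
  positivity

/-- **Level `M`, structural form** (Tubbs §5, Prop. 5.1 and the norm argument, pp. 125–127): for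
`M ≥ 1` there is `Q ∈ ℤ[T]` — the norm of `ξ = F_p^{(t₀)}(ω₁/2 + y_n) ≠ 0` — with `Q(θ) ≠ 0` and
explicit bounds for `deg Q`, `‖Q‖₁`, `|Q(θ)|`. [cite: Tubbs1990, §5 Prop. 5.1 (pp. 125–127)] -/
theorem level_struct (hM : 1 ≤ M) :
    ∃ Q : ℤ[X], Polynomial.aeval S.θ Q ≠ 0 ∧
      Q.natDegree ≤ S.d * (S.A₀ M + S.n M * S.δ₀) ∧
      zl1 Q ≤ ((S.d : ℝ) * S.HY M) ^ S.d ∧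
      ‖Polynomial.aeval S.θ Q‖ ≤ S.valB M := by
  classical
  have hd1 := S.one_le_d
  have hΘθ : 1 ≤ max 1 ‖S.θ‖ := le_max_left _ _
  -- Step 1: Siegel
  obtain ⟨pp, hpp0, hppdeg, hppB, hppeq⟩ := S.siegel_step M hM
  set p : S.Lam M → ℂ := S.pθ M pp with hp
  have hzeros : ∀ t < S.T₀ M, ∀ n₁ n₂ : ℕ, n₁ < 3 * M ^ 4 → n₂ < 3 * M ^ 4 →
      iteratedDeriv t (affF S.L S.c (S.D M) (S.L₁ M) (S.pθ M pp)) (S.zpt n₁ n₂) = 0 := by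
    intro t ht n₁ n₂ hn₁ hn₂
    exact S.iteratedDeriv_affF_eq_zero M pp (ht.le.trans (S.T₀_le M)) hn₁ hn₂ (hppeq t ht n₁ n₂ hn₁ hn₂)
  -- Step 2: the zero estimate and Schwarz
  obtain ⟨n₁, n₂, t₀, hn₁, hn₂, ht₀, hξ, hξle⟩ := S.exists_xi M hM hpp0 hzeros
  -- Step 3: the size of the coefficients
  have hCfB0 : 0 ≤ S.CfB M := S.CfB_nonneg M hM
  have hCp : ∀ l, ‖p l‖ ≤ S.Cp M := by
    intro l
    refine (norm_aeval_le_zl1 (pp l) S.θ).trans ?_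
    have h1 : zl1 (pp l) ≤ ((pp l).natDegree + 1) * S.CfB M := zl1_le_of_coeff_le _ (hppB l)
    have h2 : ((pp l).natDegree : ℝ) + 1 ≤ S.A₀ M := by exact_mod_cast hppdeg l
    have h3 : max 1 ‖S.θ‖ ^ (pp l).natDegree ≤ max 1 ‖S.θ‖ ^ S.A₀ M :=
      pow_le_pow_right₀ hΘθ (hppdeg l).le
    unfold Cp
    calc zl1 (pp l) * max 1 ‖S.θ‖ ^ (pp l).natDegree
        ≤ ((pp l).natDegree + 1) * S.CfB M * max 1 ‖S.θ‖ ^ S.A₀ M :=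
          mul_le_mul h1 h3 (by positivity) (by positivity)
      _ ≤ S.A₀ M * S.CfB M * max 1 ‖S.θ‖ ^ S.A₀ M := by gcongr
  have hCp0 : 0 ≤ S.Cp M := by unfold Cp; positivity
  have hpnorm : ‖p‖ ≤ S.Cp M := (pi_norm_le_iff_of_nonneg hCp0).mpr hCp
  -- Step 4: the norm
  set Y := homEval S.E.N S.E.b (S.n M) (S.Pmix M pp t₀ n₁ n₂) with hYdef
  have hHY0 : 0 ≤ S.HY M := S.HY_nonneg M hM
  have hYentry : ∀ i j, zl1 (Y i j) ≤ S.HY M := fun i j =>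
    S.zl1_entry_le M pp t₀ n₁ n₂ hM hCfB0 hppdeg hppB ht₀ hn₁ hn₂ i j
  have hYdeg : ∀ i j, (Y i j).natDegree ≤ S.A₀ M + S.n M * S.δ₀ := fun i j =>
    natDegree_homEval_entry_le S.natDegree_N_le S.natDegree_b_le
      (fun α hα => S.degree_le_of_mem_support_Pmix M pp ht₀ hn₁ hn₂ hα)
      (S.natDegree_coeff_Pmix_le M pp t₀ n₁ n₂ hppdeg) i j
  refine ⟨Y.det, S.aeval_det_ne_zero M pp t₀ n₁ n₂ ht₀ hn₁ hn₂ hξ, ?_, ?_, ?_⟩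
  · exact S.natDegree_det_le M pp t₀ n₁ n₂ hppdeg ht₀ hn₁ hn₂
  · exact zl1_det_le_of_entry hHY0 hYentry
  · refine (S.norm_aeval_det_le M pp t₀ n₁ n₂ hHY0 hYentry hYdeg ht₀ hn₁ hn₂).trans ?_
    unfold valB
    refine mul_le_mul_of_nonneg_right ?_ (by positivity)
    rw [norm_mul, norm_pow]
    refine mul_le_mul_of_nonneg_left ?_ (by positivity)
    refine hξle.trans ?_
    -- `‖p‖ t₀! e^{C_A(… + t₀)} e^{-…} ≤ C_p (3T')! e^{C_A(… + 3T')} e^{-…}`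
    unfold ξB
    have hCA := S.CA_nonneg
    have hfact : ((t₀.factorial : ℕ) : ℝ) ≤ (3 * S.T' M).factorial := by
      exact_mod_cast Nat.factorial_le ht₀
    have hexp : Real.exp (S.CA * ((S.D M + S.L₁ M + 1) * (3 * M ^ 4 : ℕ) ^ 2 + t₀)) ≤
        Real.exp (S.CA * ((S.D M + S.L₁ M + 1) * (3 * M ^ 4 : ℕ) ^ 2 + (3 * S.T' M : ℕ))) := by
      apply Real.exp_le_exp.mpr
      have : (t₀ : ℝ) ≤ (3 * S.T' M : ℕ) := by exact_mod_cast ht₀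
      gcongr
    gcongr

end Level

/-! ### Exponential bookkeeping: generic inequalities -/

section Exp

/-- `x ≤ e^x`. [folklore] -/
lemma le_exp_self (x : ℝ) : x ≤ Real.exp x := by linarith [Real.add_one_le_exp x]

/-- `m^k ≤ e^{km}` for `m ≥ 0`. [folklore] -/
lemma pow_le_exp_mul {m : ℝ} (hm : 0 ≤ m) (k : ℕ) : m ^ k ≤ Real.exp (k * m) := by
  rw [Real.exp_nat_mul]
  exact pow_le_pow_left₀ hm (le_exp_self m) k

/-- `c m^k ≤ e^{(c + k) m}` for `c ≥ 0`, `m ≥ 1`. [folklore] -/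
lemma const_mul_pow_le_exp {c m : ℝ} (hc : 0 ≤ c) (hm : 1 ≤ m) (k : ℕ) :
    c * m ^ k ≤ Real.exp ((c + k) * m) := by
  have h1 : c ≤ Real.exp (c * m) := (le_exp_self c).trans (Real.exp_le_exp.mpr (by nlinarith))
  have h2 := pow_le_exp_mul (by linarith : (0 : ℝ) ≤ m) k
  calc c * m ^ k ≤ Real.exp (c * m) * Real.exp (k * m) :=
        mul_le_mul h1 h2 (by positivity) (by positivity)
    _ = Real.exp ((c + k) * m) := by rw [← Real.exp_add]; ring_nf

/-- `m ≤ m⁷` for `m ≥ 1`. [folklore] -/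
lemma le_pow_seven {m : ℝ} (hm : 1 ≤ m) : m ≤ m ^ 7 := by
  calc m = m ^ 1 := (pow_one m).symm
    _ ≤ m ^ 7 := pow_le_pow_right₀ hm (by norm_num)

/-- `c m^k ≤ e^{(c + k) m⁷}` for `c ≥ 0`, `m ≥ 1`. [folklore] -/
lemma const_mul_pow_le_exp7 {c m : ℝ} (hc : 0 ≤ c) (hm : 1 ≤ m) (k : ℕ) :
    c * m ^ k ≤ Real.exp ((c + k) * m ^ 7) :=
  (const_mul_pow_le_exp hc hm k).trans
    (Real.exp_le_exp.mpr (mul_le_mul_of_nonneg_left (le_pow_seven hm) (by positivity)))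

/-- Powers with exponent `≤ e₀ m⁶` of a base `≤ e^{k m}`: `b^e ≤ e^{k e₀ m⁷}`. [folklore] -/
lemma pow_le_exp7 {b k m e₀ : ℝ} {e : ℕ} (hb0 : 0 ≤ b) (hb : b ≤ Real.exp (k * m)) (hk : 0 ≤ k)
    (hm : 0 ≤ m) (he : (e : ℝ) ≤ e₀ * m ^ 6) : b ^ e ≤ Real.exp (k * e₀ * m ^ 7) := by
  calc b ^ e ≤ Real.exp (k * m) ^ e := pow_le_pow_left₀ hb0 hb e
    _ = Real.exp (e * (k * m)) := (Real.exp_nat_mul _ _).symm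
    _ ≤ Real.exp (k * e₀ * m ^ 7) := by
        apply Real.exp_le_exp.mpr
        have hkm : 0 ≤ k * m := mul_nonneg hk hm
        calc (e : ℝ) * (k * m) ≤ e₀ * m ^ 6 * (k * m) := mul_le_mul_of_nonneg_right he hkm
          _ = k * e₀ * m ^ 7 := by ring

/-- Powers with exponent `≤ e₀ m⁶` of a constant base `B ≥ 1`: `B^e ≤ e^{e₀ log B · m⁷}` (`m ≥ 1`).
[folklore] -/
lemma const_pow_le_exp7 {B m e₀ : ℝ} {e : ℕ} (hB : 1 ≤ B) (hm : 1 ≤ m) (he₀ : 0 ≤ e₀)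
    (he : (e : ℝ) ≤ e₀ * m ^ 6) : B ^ e ≤ Real.exp (e₀ * Real.log B * m ^ 7) := by
  have hlog : 0 ≤ Real.log B := Real.log_nonneg hB
  have hBpos : 0 < B := by linarith
  calc B ^ e = Real.exp (e * Real.log B) := by rw [Real.exp_nat_mul, Real.exp_log hBpos]
    _ ≤ Real.exp (e₀ * Real.log B * m ^ 7) := by
        apply Real.exp_le_exp.mpr
        have h67 : m ^ 6 ≤ m ^ 7 := pow_le_pow_right₀ hm (by norm_num)
        calc (e : ℝ) * Real.log B ≤ e₀ * m ^ 6 * Real.log B := mul_le_mul_of_nonneg_right he hlog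
          _ ≤ e₀ * m ^ 7 * Real.log B := by gcongr
          _ = e₀ * Real.log B * m ^ 7 := by ring

/-- Products of bounds by powers of one quantity. [folklore] -/
lemma mul_le_pow_add {H a b : ℝ} {i j : ℕ} (hH : 0 ≤ H) (ha : a ≤ H ^ i) (hb : b ≤ H ^ j)
    (hb0 : 0 ≤ b) : a * b ≤ H ^ (i + j) := by
  rw [pow_add]
  exact mul_le_mul ha hb hb0 (pow_nonneg hH _)

/-- `x ≤ H = H¹`. [folklore] -/
lemma le_pow_one_of_le {x H : ℝ} (h : x ≤ H) : x ≤ H ^ 1 := by rwa [pow_one]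

end Exp

/-! ### Exponential bookkeeping: the constants `k_*` and the scale `H = e^{k_H M⁷}` -/

section ExpBounds

/-- `max(1, |θ|)`. [folklore] -/
def θm : ℝ := max 1 ‖S.θ‖

/-- `max(1, |b(θ)|)`. [folklore] -/
def bm : ℝ := max 1 ‖Polynomial.aeval S.θ S.E.b‖

/-- `1 ≤ θm`. [folklore] -/
lemma one_le_θm : 1 ≤ S.θm := le_max_left _ _

/-- `1 ≤ bm`. [folklore] -/
lemma one_le_bm : 1 ≤ S.bm := le_max_left _ _

/-- `#Λ ≤ e^{k_card M⁷}`, `k_card = 8K₀³ + 18`. [folklore] -/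
def kcard : ℝ := 8 * (S.K₀ : ℝ) ^ 3 + 18

/-- `A₀ ≤ e^{k_A M⁷}`, `k_A = νδ₀ + 7`. [folklore] -/
def kA : ℝ := ((S.ν * S.δ₀ : ℕ) : ℝ) + 7

/-- `l1B ≤ e^{k_l1B M⁷}`. [folklore] -/
def kl1B : ℝ := (15 * (S.K₀ : ℝ) + 21 * S.Λ + 6) * (3 * S.Λ) + 13 * (2 * (S.K₀ : ℝ) + 3 * S.Λ)

/-- `d⁷ (dH₀)^n ≤ e^{k_dd M⁷}`. [folklore] -/
def kdd : ℝ := 7 * (S.d : ℝ) + S.ν * Real.log (S.d * S.H₀)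

/-- `max(1,|θ|)^{A₀ + nδ₀} ≤ e^{k_θ M⁷}`. [folklore] -/
def kθ : ℝ := (2 * ((S.ν * S.δ₀ : ℕ) : ℝ) + 1) * Real.log S.θm

/-- `(3T')! ≤ e^{k_fact M⁷}`. [folklore] -/
def kfact : ℝ := (3 * (S.Λ : ℝ) + 6) * (3 * S.Λ)

/-- `|b(θ)|^n ≤ e^{k_b M⁷}`. [folklore] -/
def kb : ℝ := S.ν * Real.log S.bm

/-- `e^{C_A t₀} ≤ e^{k_main M⁷}`. [folklore] -/
def kmain : ℝ := 3 * S.CA * S.Λ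

/-- `d, 2 ≤ e^{k_d M⁷}`, `k_d = d + 1`. [folklore] -/
def kd : ℝ := (S.d : ℝ) + 1

/-- **The height constant** `k_H`: every factor of the bounds at level `M` is `≤ H = e^{k_H M⁷}`.
[folklore] -/
def kH : ℝ := S.kcard + S.kA + S.kl1B + S.kdd + S.kθ + S.kfact + S.kb + S.kmain + S.kd

/-- `0 ≤ k_card`. [folklore] -/
lemma kcard_nonneg : 0 ≤ S.kcard := by unfold kcard; positivity
/-- `0 ≤ k_A`. [folklore] -/
lemma kA_nonneg : 0 ≤ S.kA := by unfold kA; positivity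
/-- `0 ≤ k_l1B`. [folklore] -/
lemma kl1B_nonneg : 0 ≤ S.kl1B := by unfold kl1B; positivity
/-- `0 ≤ k_dd`. [folklore] -/
lemma kdd_nonneg : 0 ≤ S.kdd := by
  unfold kdd
  have h : 0 ≤ Real.log (S.d * S.H₀) := by
    refine Real.log_nonneg ?_
    have hd : (1 : ℝ) ≤ S.d := by exact_mod_cast S.one_le_d
    nlinarith [S.one_le_H₀]
  positivity
/-- `0 ≤ k_θ`. [folklore] -/
lemma kθ_nonneg : 0 ≤ S.kθ := by
  unfold kθ
  have h : 0 ≤ Real.log S.θm := Real.log_nonneg S.one_le_θm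
  positivity
/-- `0 ≤ k_fact`. [folklore] -/
lemma kfact_nonneg : 0 ≤ S.kfact := by unfold kfact; positivity
/-- `0 ≤ k_b`. [folklore] -/
lemma kb_nonneg : 0 ≤ S.kb := by
  unfold kb
  have h : 0 ≤ Real.log S.bm := Real.log_nonneg S.one_le_bm
  positivity
/-- `0 ≤ k_main`. [folklore] -/
lemma kmain_nonneg : 0 ≤ S.kmain := by unfold kmain; have := S.CA_nonneg; positivity
/-- `1 ≤ k_d`. [folklore] -/
lemma one_le_kd : 1 ≤ S.kd := by unfold kd; have : (0 : ℝ) ≤ S.d := Nat.cast_nonneg _; linarith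

/-- `1 ≤ k_H`. [folklore] -/
lemma one_le_kH : 1 ≤ S.kH := by
  unfold kH
  linarith [S.kcard_nonneg, S.kA_nonneg, S.kl1B_nonneg, S.kdd_nonneg, S.kθ_nonneg, S.kfact_nonneg,
    S.kb_nonneg, S.kmain_nonneg, S.one_le_kd]

/-- `0 ≤ k_H`. [folklore] -/
lemma kH_nonneg : 0 ≤ S.kH := le_trans zero_le_one S.one_le_kH

variable (M : ℕ)

/-- **The scale** `H = e^{k_H M⁷}`. [folklore] -/
def Hs : ℝ := Real.exp (S.kH * (M : ℝ) ^ 7)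

/-- `0 < H`. [folklore] -/
lemma Hs_pos : 0 < S.Hs M := Real.exp_pos _

/-- `1 ≤ H`. [folklore] -/
lemma one_le_Hs : 1 ≤ S.Hs M := by
  unfold Hs
  exact Real.one_le_exp (by have := S.kH_nonneg; positivity)

/-- Transfer of a bound `≤ e^{k M⁷}` with `k ≤ k_H` to `≤ H`. [folklore] -/
lemma le_Hs {x k : ℝ} (hx : x ≤ Real.exp (k * (M : ℝ) ^ 7)) (hk : k ≤ S.kH) : x ≤ S.Hs M :=
  hx.trans (Real.exp_le_exp.mpr (mul_le_mul_of_nonneg_right hk (by positivity)))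

/-- Powers of `H` are monotone. [folklore] -/
lemma Hs_pow_mono {i j : ℕ} (h : i ≤ j) : S.Hs M ^ i ≤ S.Hs M ^ j :=
  pow_le_pow_right₀ (S.one_le_Hs M) h

variable {M}

/-- `1 ≤ K₀ M⁶` (as reals) for `M ≥ 1`. [folklore] -/
lemma one_le_K₀M6 (hM : 1 ≤ M) : (1 : ℝ) ≤ S.K₀ * (M : ℝ) ^ 6 := by
  have h1 : (1 : ℝ) ≤ S.K₀ := by exact_mod_cast S.one_le_K₀
  have h2 : (1 : ℝ) ≤ (M : ℝ) ^ 6 := one_le_pow₀ (by exact_mod_cast hM)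
  nlinarith

/-- `#Λ ≤ H`. [folklore] -/
lemma card_le_Hs (hM : 1 ≤ M) : (Fintype.card (S.Lam M) : ℝ) ≤ S.Hs M := by
  have hm : (1 : ℝ) ≤ M := by exact_mod_cast hM
  have hK : (0 : ℝ) ≤ S.K₀ := Nat.cast_nonneg _
  have h1 := S.one_le_K₀M6 hM
  have hcard : (Fintype.card (S.Lam M) : ℝ) = ((S.D M : ℝ) + 1) * (((S.L₁ M : ℝ) + 1) * ((S.D M : ℝ) + 1)) := by
    simp only [Lam, Coeff, Fintype.card_prod, Fintype.card_fin]
    push_cast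
    ring
  have hD : (S.D M : ℝ) + 1 ≤ 2 * (S.K₀ * (M : ℝ) ^ 6) := by
    unfold D; push_cast; linarith
  have hL : (S.L₁ M : ℝ) + 1 ≤ 2 * (S.K₀ * (M : ℝ) ^ 6) := by
    unfold L₁; push_cast
    have : (M : ℝ) ^ 2 ≤ (M : ℝ) ^ 6 := pow_le_pow_right₀ hm (by norm_num)
    nlinarith
  have hle : (Fintype.card (S.Lam M) : ℝ) ≤ (8 * (S.K₀ : ℝ) ^ 3) * (M : ℝ) ^ 18 := by
    rw [hcard]
    calc ((S.D M : ℝ) + 1) * (((S.L₁ M : ℝ) + 1) * ((S.D M : ℝ) + 1))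
        ≤ (2 * (S.K₀ * (M : ℝ) ^ 6)) * ((2 * (S.K₀ * (M : ℝ) ^ 6)) * (2 * (S.K₀ * (M : ℝ) ^ 6))) := by
          gcongr
      _ = (8 * (S.K₀ : ℝ) ^ 3) * (M : ℝ) ^ 18 := by ring
  refine S.le_Hs M (hle.trans (const_mul_pow_le_exp7 (by positivity) hm 18)) ?_
  unfold kH kcard
  push_cast
  linarith [S.kA_nonneg, S.kl1B_nonneg, S.kdd_nonneg, S.kθ_nonneg, S.kfact_nonneg, S.kb_nonneg,
    S.kmain_nonneg, S.one_le_kd]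

/-- `A₀ ≤ (νδ₀ + 1) M⁶`. [folklore] -/
lemma A₀_le (hM : 1 ≤ M) : (S.A₀ M : ℝ) ≤ (((S.ν * S.δ₀ : ℕ) : ℝ) + 1) * (M : ℝ) ^ 6 := by
  unfold A₀ n
  have h6 : (1 : ℝ) ≤ (M : ℝ) ^ 6 := one_le_pow₀ (by exact_mod_cast hM)
  push_cast
  nlinarith

/-- `A₀ + nδ₀ ≤ (2νδ₀ + 1) M⁶`. [folklore] -/
lemma A₀_add_le (hM : 1 ≤ M) :
    ((S.A₀ M + S.n M * S.δ₀ : ℕ) : ℝ) ≤ (2 * ((S.ν * S.δ₀ : ℕ) : ℝ) + 1) * (M : ℝ) ^ 6 := by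
  unfold A₀ n
  have h6 : (1 : ℝ) ≤ (M : ℝ) ^ 6 := one_le_pow₀ (by exact_mod_cast hM)
  push_cast
  nlinarith

/-- `A₀ ≤ H`. [folklore] -/
lemma A₀_le_Hs (hM : 1 ≤ M) : (S.A₀ M : ℝ) ≤ S.Hs M := by
  have hm : (1 : ℝ) ≤ M := by exact_mod_cast hM
  refine S.le_Hs M ((S.A₀_le hM).trans (const_mul_pow_le_exp7 (by positivity) hm 6)) ?_
  unfold kH kA
  push_cast
  linarith [S.kcard_nonneg, S.kl1B_nonneg, S.kdd_nonneg, S.kθ_nonneg, S.kfact_nonneg, S.kb_nonneg,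
    S.kmain_nonneg, S.one_le_kd]

/-- `l1B ≤ H`. [folklore] -/
lemma l1B_le_Hs (hM : 1 ≤ M) : S.l1B M ≤ S.Hs M := by
  have hm : (1 : ℝ) ≤ M := by exact_mod_cast hM
  have hm0 : (0 : ℝ) ≤ M := by linarith
  have hK : (0 : ℝ) ≤ S.K₀ := Nat.cast_nonneg _
  have hΛ : (0 : ℝ) ≤ S.Λ := Nat.cast_nonneg _
  -- `B₁ ≤ (15K₀ + 21Λ) M⁶ ≤ e^{(15K₀+21Λ+6)M}`
  have hB1 : S.B1 M ≤ (15 * (S.K₀ : ℝ) + 21 * S.Λ) * (M : ℝ) ^ 6 := by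
    unfold B1 D T' L₁
    push_cast
    have : (M : ℝ) ^ 2 ≤ (M : ℝ) ^ 6 := pow_le_pow_right₀ hm (by norm_num)
    nlinarith
  have hB1e : S.B1 M ≤ Real.exp ((15 * (S.K₀ : ℝ) + 21 * S.Λ + (6 : ℕ)) * M) :=
    hB1.trans (const_mul_pow_le_exp (by positivity) hm 6)
  have hB10 : 0 ≤ S.B1 M := le_trans zero_le_one (S.one_le_B1 M hM)
  have he1 : ((3 * S.T' M : ℕ) : ℝ) ≤ (3 * S.Λ) * (M : ℝ) ^ 6 := by unfold T'; push_cast; nlinarith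
  have h1 := pow_le_exp7 hB10 hB1e (by positivity) hm0 he1
  -- `B₂ = 9M⁴ ≤ e^{13M}`
  have hB2e : B2 M ≤ Real.exp ((9 + (4 : ℕ)) * M) := by
    unfold B2
    exact const_mul_pow_le_exp (by norm_num) hm 4
  have hB20 : 0 ≤ B2 M := le_trans zero_le_one (one_le_B2 M hM)
  have he2 : ((2 * S.D M + 3 * S.T' M : ℕ) : ℝ) ≤ (2 * (S.K₀ : ℝ) + 3 * S.Λ) * (M : ℝ) ^ 6 := by
    unfold D T'; push_cast; nlinarith
  have h2 := pow_le_exp7 hB20 hB2e (by positivity) hm0 he2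
  have hprod : S.l1B M ≤ Real.exp (S.kl1B * (M : ℝ) ^ 7) := by
    unfold l1B
    refine (mul_le_mul h1 h2 (by positivity) (by positivity)).trans ?_
    rw [← Real.exp_add]
    apply Real.exp_le_exp.mpr
    unfold kl1B
    push_cast
    nlinarith [pow_nonneg hm0 7]
  refine S.le_Hs M hprod ?_
  unfold kH
  linarith [S.kcard_nonneg, S.kA_nonneg, S.kdd_nonneg, S.kθ_nonneg, S.kfact_nonneg, S.kb_nonneg,
    S.kmain_nonneg, S.one_le_kd]

/-- `d⁷ (dH₀)^n ≤ H`. [folklore] -/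
lemma dd_le_Hs (hM : 1 ≤ M) : (S.d : ℝ) ^ 7 * (S.d * S.H₀) ^ S.n M ≤ S.Hs M := by
  have hm : (1 : ℝ) ≤ M := by exact_mod_cast hM
  have hm7 : (1 : ℝ) ≤ (M : ℝ) ^ 7 := one_le_pow₀ hm
  have hd : (1 : ℝ) ≤ S.d := by exact_mod_cast S.one_le_d
  have hdH : (1 : ℝ) ≤ S.d * S.H₀ := by nlinarith [S.one_le_H₀]
  have h1 : (S.d : ℝ) ^ 7 ≤ Real.exp (7 * (S.d : ℝ) * (M : ℝ) ^ 7) := by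
    calc (S.d : ℝ) ^ 7 ≤ Real.exp (S.d : ℝ) ^ 7 := pow_le_pow_left₀ (by positivity) (le_exp_self _) 7
      _ = Real.exp (7 * (S.d : ℝ)) := by rw [← Real.exp_nat_mul]; norm_num
      _ ≤ Real.exp (7 * (S.d : ℝ) * (M : ℝ) ^ 7) := Real.exp_le_exp.mpr (by nlinarith)
  have he : ((S.n M : ℕ) : ℝ) ≤ (S.ν : ℝ) * (M : ℝ) ^ 6 := by unfold n; push_cast; exact le_rfl
  have h2 := const_pow_le_exp7 hdH hm (Nat.cast_nonneg _) he
  have hprod : (S.d : ℝ) ^ 7 * (S.d * S.H₀) ^ S.n M ≤ Real.exp (S.kdd * (M : ℝ) ^ 7) := by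
    refine (mul_le_mul h1 h2 (by positivity) (by positivity)).trans ?_
    rw [← Real.exp_add]
    apply Real.exp_le_exp.mpr
    unfold kdd
    nlinarith
  refine S.le_Hs M hprod ?_
  unfold kH
  linarith [S.kcard_nonneg, S.kA_nonneg, S.kl1B_nonneg, S.kθ_nonneg, S.kfact_nonneg, S.kb_nonneg,
    S.kmain_nonneg, S.one_le_kd]

/-- `max(1,|θ|)^{A₀ + nδ₀} ≤ H`. [folklore] -/
lemma θpow_le_Hs (hM : 1 ≤ M) : S.θm ^ (S.A₀ M + S.n M * S.δ₀) ≤ S.Hs M := by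
  have hm : (1 : ℝ) ≤ M := by exact_mod_cast hM
  have h := const_pow_le_exp7 S.one_le_θm hm (by positivity) (S.A₀_add_le hM)
  refine S.le_Hs M h ?_
  unfold kH kθ
  linarith [S.kcard_nonneg, S.kA_nonneg, S.kl1B_nonneg, S.kdd_nonneg, S.kfact_nonneg, S.kb_nonneg,
    S.kmain_nonneg, S.one_le_kd]

/-- `max(1,|θ|)^{A₀} ≤ H`. [folklore] -/
lemma θpow_le_Hs' (hM : 1 ≤ M) : S.θm ^ S.A₀ M ≤ S.Hs M :=
  (pow_le_pow_right₀ S.one_le_θm (Nat.le_add_right _ _)).trans (S.θpow_le_Hs hM)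

/-- `(3T')! ≤ H`. [folklore] -/
lemma fact_le_Hs (hM : 1 ≤ M) : (((3 * S.T' M).factorial : ℕ) : ℝ) ≤ S.Hs M := by
  have hm : (1 : ℝ) ≤ M := by exact_mod_cast hM
  have hm0 : (0 : ℝ) ≤ M := by linarith
  have hΛ : (0 : ℝ) ≤ S.Λ := Nat.cast_nonneg _
  have h1 : (((3 * S.T' M).factorial : ℕ) : ℝ) ≤ ((3 * S.T' M : ℕ) : ℝ) ^ (3 * S.T' M) := by
    exact_mod_cast Nat.factorial_le_pow (3 * S.T' M)
  have hbase : ((3 * S.T' M : ℕ) : ℝ) = (3 * (S.Λ : ℝ)) * (M : ℝ) ^ 6 := by unfold T'; push_cast; ring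
  have hbe : ((3 * S.T' M : ℕ) : ℝ) ≤ Real.exp ((3 * (S.Λ : ℝ) + (6 : ℕ)) * M) := by
    rw [hbase]; exact const_mul_pow_le_exp (by positivity) hm 6
  have he : ((3 * S.T' M : ℕ) : ℝ) ≤ (3 * (S.Λ : ℝ)) * (M : ℝ) ^ 6 := le_of_eq hbase
  have h2 := pow_le_exp7 (Nat.cast_nonneg _) hbe (by positivity) hm0 he
  refine S.le_Hs M (h1.trans h2) ?_
  unfold kH kfact
  push_cast
  linarith [S.kcard_nonneg, S.kA_nonneg, S.kl1B_nonneg, S.kdd_nonneg, S.kθ_nonneg, S.kb_nonneg,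
    S.kmain_nonneg, S.one_le_kd]

/-- `|b(θ)|^n ≤ H`. [folklore] -/
lemma bpow_le_Hs (hM : 1 ≤ M) : ‖Polynomial.aeval S.θ S.E.b‖ ^ S.n M ≤ S.Hs M := by
  have hm : (1 : ℝ) ≤ M := by exact_mod_cast hM
  have h0 : ‖Polynomial.aeval S.θ S.E.b‖ ^ S.n M ≤ S.bm ^ S.n M :=
    pow_le_pow_left₀ (norm_nonneg _) (le_max_right _ _) _
  have he : ((S.n M : ℕ) : ℝ) ≤ (S.ν : ℝ) * (M : ℝ) ^ 6 := by unfold n; push_cast; exact le_rfl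
  have h := const_pow_le_exp7 S.one_le_bm hm (Nat.cast_nonneg _) he
  refine S.le_Hs M (h0.trans h) ?_
  unfold kH kb
  linarith [S.kcard_nonneg, S.kA_nonneg, S.kl1B_nonneg, S.kdd_nonneg, S.kθ_nonneg, S.kfact_nonneg,
    S.kmain_nonneg, S.one_le_kd]

/-- `d ≤ H`. [folklore] -/
lemma d_le_Hs (hM : 1 ≤ M) : (S.d : ℝ) ≤ S.Hs M := by
  have hm : (1 : ℝ) ≤ M := by exact_mod_cast hM
  have hm7 : (1 : ℝ) ≤ (M : ℝ) ^ 7 := one_le_pow₀ hm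
  have hd0 : (0 : ℝ) ≤ S.d := Nat.cast_nonneg _
  have h : (S.d : ℝ) ≤ Real.exp (S.kd * (M : ℝ) ^ 7) := by
    refine (le_exp_self _).trans (Real.exp_le_exp.mpr ?_)
    unfold kd; nlinarith
  refine S.le_Hs M h ?_
  unfold kH
  linarith [S.kcard_nonneg, S.kA_nonneg, S.kl1B_nonneg, S.kdd_nonneg, S.kθ_nonneg, S.kfact_nonneg,
    S.kb_nonneg, S.kmain_nonneg]

/-- `2 ≤ H`. [folklore] -/
lemma two_le_Hs (hM : 1 ≤ M) : (2 : ℝ) ≤ S.Hs M := by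
  have hm : (1 : ℝ) ≤ M := by exact_mod_cast hM
  have hm7 : (1 : ℝ) ≤ (M : ℝ) ^ 7 := one_le_pow₀ hm
  have h : (2 : ℝ) ≤ Real.exp (S.kd * (M : ℝ) ^ 7) := by
    have h1 : (2 : ℝ) ≤ Real.exp 1 := by linarith [Real.add_one_le_exp (1 : ℝ)]
    refine h1.trans (Real.exp_le_exp.mpr ?_)
    have := S.one_le_kd
    nlinarith
  refine S.le_Hs M h ?_
  unfold kH
  linarith [S.kcard_nonneg, S.kA_nonneg, S.kl1B_nonneg, S.kdd_nonneg, S.kθ_nonneg, S.kfact_nonneg,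
    S.kb_nonneg, S.kmain_nonneg]

/-- **The main term**: `e^{C_A((D+L₁+1)(3M⁴)² + 3T')} · e^{-T₀(3M⁴)²} ≤ H · e^{-27 K₀ M¹⁴}`
(`T₀ = 3C₁K₀M⁶`, `C₁ ≥ C_A + 1`). [folklore] -/
lemma main_le_Hs (hM : 1 ≤ M) :
    Real.exp (S.CA * ((S.D M + S.L₁ M + 1) * (3 * M ^ 4 : ℕ) ^ 2 + (3 * S.T' M : ℕ))) *
        Real.exp (-(S.T₀ M * (3 * M ^ 4 : ℕ) ^ 2 : ℝ)) ≤
      S.Hs M * Real.exp (-(27 * S.K₀ * (M : ℝ) ^ 14)) := by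
  have hm : (1 : ℝ) ≤ M := by exact_mod_cast hM
  set x : ℝ := (M : ℝ) with hx
  set a : ℝ := S.CA with ha
  set K : ℝ := (S.K₀ : ℝ) with hK
  set l : ℝ := (S.Λ : ℝ) with hl
  have ha0 : 0 ≤ a := S.CA_nonneg
  have hK1 : 1 ≤ K := by rw [hK]; exact_mod_cast S.one_le_K₀
  have hl0 : 0 ≤ l := Nat.cast_nonneg _
  have hC1 : a + 1 ≤ (S.C1 : ℝ) := S.CA_add_one_le_C1
  have hx10 : x ^ 10 ≤ x ^ 14 := pow_le_pow_right₀ hm (by norm_num)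
  have hx8 : x ^ 8 ≤ x ^ 14 := pow_le_pow_right₀ hm (by norm_num)
  have hx6 : x ^ 6 ≤ x ^ 7 := pow_le_pow_right₀ hm (by norm_num)
  have e1 : a * K * x ^ 10 ≤ a * K * x ^ 14 := mul_le_mul_of_nonneg_left hx10 (by positivity)
  have e2 : a * x ^ 8 ≤ a * K * x ^ 14 := by
    calc a * x ^ 8 ≤ a * x ^ 14 := mul_le_mul_of_nonneg_left hx8 ha0
      _ = a * 1 * x ^ 14 := by ring
      _ ≤ a * K * x ^ 14 := by gcongr
  have e3 : a * l * x ^ 6 ≤ a * l * x ^ 7 := mul_le_mul_of_nonneg_left hx6 (by positivity)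
  have e4 : (a + 1) * (K * x ^ 14) ≤ (S.C1 : ℝ) * (K * x ^ 14) :=
    mul_le_mul_of_nonneg_right hC1 (by positivity)
  have key : S.CA * ((S.D M + S.L₁ M + 1) * (3 * M ^ 4 : ℕ) ^ 2 + (3 * S.T' M : ℕ)) +
      -(S.T₀ M * (3 * M ^ 4 : ℕ) ^ 2 : ℝ) ≤ S.kmain * x ^ 7 + -(27 * S.K₀ * x ^ 14) := by
    unfold D L₁ T' T₀ kmain
    push_cast
    rw [← ha, ← hK, ← hl, ← hx]
    linarith [e1, e2, e3, e4]
  rw [← Real.exp_add, Hs, ← Real.exp_add]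
  apply Real.exp_le_exp.mpr
  refine key.trans ?_
  have hkm : S.kmain ≤ S.kH := by
    unfold kH
    linarith [S.kcard_nonneg, S.kA_nonneg, S.kl1B_nonneg, S.kdd_nonneg, S.kθ_nonneg, S.kfact_nonneg,
      S.kb_nonneg, S.one_le_kd]
  have : S.kmain * x ^ 7 ≤ S.kH * x ^ 7 := mul_le_mul_of_nonneg_right hkm (by positivity)
  rw [hx] at this ⊢
  linarith

/-- `Bsieg ≤ H²`. [folklore] -/
lemma Bsieg_le (hM : 1 ≤ M) : S.Bsieg M ≤ S.Hs M ^ 2 := by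
  unfold Bsieg
  have h := mul_le_pow_add (S.Hs_pos M).le (i := 1) (j := 1)
    (le_pow_one_of_le (S.l1B_le_Hs hM)) (le_pow_one_of_le (S.dd_le_Hs hM))
    (by have := S.H₀_nonneg; positivity)
  exact h

/-- `CfB ≤ H⁴`. [folklore] -/
lemma CfB_le (hM : 1 ≤ M) : S.CfB M ≤ S.Hs M ^ 4 := by
  unfold CfB
  have h0 := (S.Hs_pos M).le
  have h1 : (Fintype.card (S.Lam M) : ℝ) * S.A₀ M ≤ S.Hs M ^ (1 + 1) :=
    mul_le_pow_add h0 (le_pow_one_of_le (S.card_le_Hs hM)) (le_pow_one_of_le (S.A₀_le_Hs hM))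
      (Nat.cast_nonneg _)
  exact mul_le_pow_add h0 h1 (S.Bsieg_le hM) (le_trans zero_le_one (S.one_le_Bsieg M hM))

/-- `C_p ≤ H⁶`. [folklore] -/
lemma Cp_le (hM : 1 ≤ M) : S.Cp M ≤ S.Hs M ^ 6 := by
  unfold Cp
  have h0 := (S.Hs_pos M).le
  have h1 : (S.A₀ M : ℝ) * S.CfB M ≤ S.Hs M ^ (1 + 4) :=
    mul_le_pow_add h0 (le_pow_one_of_le (S.A₀_le_Hs hM)) (S.CfB_le hM) (S.CfB_nonneg M hM)
  exact mul_le_pow_add h0 h1 (le_pow_one_of_le (S.θpow_le_Hs' hM)) (by have := S.one_le_θm; positivity)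

/-- `ξB ≤ H⁸ · e^{-27 K₀ M¹⁴}`. [folklore] -/
lemma ξB_le (hM : 1 ≤ M) : S.ξB M ≤ S.Hs M ^ 8 * Real.exp (-(27 * S.K₀ * (M : ℝ) ^ 14)) := by
  unfold ξB
  have h0 := (S.Hs_pos M).le
  have h1 : S.Cp M * ((3 * S.T' M).factorial : ℕ) ≤ S.Hs M ^ (6 + 1) :=
    mul_le_pow_add h0 (S.Cp_le hM) (le_pow_one_of_le (S.fact_le_Hs hM)) (Nat.cast_nonneg _)
  have h2 := S.main_le_Hs hM
  rw [mul_assoc (S.Cp M * _)]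
  calc S.Cp M * ((3 * S.T' M).factorial : ℕ) *
        (Real.exp (S.CA * ((S.D M + S.L₁ M + 1) * (3 * M ^ 4 : ℕ) ^ 2 + (3 * S.T' M : ℕ))) *
          Real.exp (-(S.T₀ M * (3 * M ^ 4 : ℕ) ^ 2 : ℝ)))
      ≤ S.Hs M ^ (6 + 1) * (S.Hs M * Real.exp (-(27 * S.K₀ * (M : ℝ) ^ 14))) :=
        mul_le_mul h1 h2 (by positivity) (by positivity)
    _ = S.Hs M ^ 8 * Real.exp (-(27 * S.K₀ * (M : ℝ) ^ 14)) := by ring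

/-- `H_Y ≤ H⁸`. [folklore] -/
lemma HY_le (hM : 1 ≤ M) : S.HY M ≤ S.Hs M ^ 8 := by
  unfold HY
  have h0 := (S.Hs_pos M).le
  have h1 : (S.A₀ M : ℝ) * S.CfB M ≤ S.Hs M ^ (1 + 4) :=
    mul_le_pow_add h0 (le_pow_one_of_le (S.A₀_le_Hs hM)) (S.CfB_le hM) (S.CfB_nonneg M hM)
  have h2 : (Fintype.card (S.Lam M) : ℝ) * (S.A₀ M * S.CfB M) ≤ S.Hs M ^ (1 + (1 + 4)) :=
    mul_le_pow_add h0 (le_pow_one_of_le (S.card_le_Hs hM)) h1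
      (by have := S.CfB_nonneg M hM; positivity)
  have h3 : (Fintype.card (S.Lam M) : ℝ) * (S.A₀ M * S.CfB M) * S.l1B M ≤ S.Hs M ^ (1 + (1 + 4) + 1) :=
    mul_le_pow_add h0 h2 (le_pow_one_of_le (S.l1B_le_Hs hM))
      (le_trans zero_le_one (S.one_le_l1B M hM))
  exact mul_le_pow_add h0 h3 (le_pow_one_of_le (S.dd_le_Hs hM)) (by have := S.H₀_nonneg; positivity)

/-- The cofactor bound: `d (1 + d H_Y max(1,|θ|)^{A₀+nδ₀})^d ≤ H^{11d + 1}`. [folklore] -/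
lemma cof_le (hM : 1 ≤ M) :
    (S.d : ℝ) * (1 + S.d * (S.HY M * max 1 ‖S.θ‖ ^ (S.A₀ M + S.n M * S.δ₀))) ^ S.d ≤
      S.Hs M ^ (11 * S.d + 1) := by
  have h0 := (S.Hs_pos M).le
  have h1H := S.one_le_Hs M
  have hx : (S.d : ℝ) * (S.HY M * max 1 ‖S.θ‖ ^ (S.A₀ M + S.n M * S.δ₀)) ≤ S.Hs M ^ (1 + (8 + 1)) :=
    mul_le_pow_add h0 (le_pow_one_of_le (S.d_le_Hs hM))
      (mul_le_pow_add h0 (S.HY_le hM) (le_pow_one_of_le (S.θpow_le_Hs hM)) (by positivity))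
      (by have := S.HY_nonneg M hM; positivity)
  have hin : 1 + (S.d : ℝ) * (S.HY M * max 1 ‖S.θ‖ ^ (S.A₀ M + S.n M * S.δ₀)) ≤ S.Hs M ^ 11 := by
    have h10 : (1 : ℝ) ≤ S.Hs M ^ 10 := one_le_pow₀ h1H
    calc 1 + (S.d : ℝ) * (S.HY M * max 1 ‖S.θ‖ ^ (S.A₀ M + S.n M * S.δ₀))
        ≤ S.Hs M ^ 10 + S.Hs M ^ 10 := add_le_add h10 hx
      _ = 2 * S.Hs M ^ 10 := by ring
      _ ≤ S.Hs M * S.Hs M ^ 10 := mul_le_mul_of_nonneg_right (S.two_le_Hs hM) (by positivity)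
      _ = S.Hs M ^ 11 := by ring
  have hpow : (1 + (S.d : ℝ) * (S.HY M * max 1 ‖S.θ‖ ^ (S.A₀ M + S.n M * S.δ₀))) ^ S.d ≤
      S.Hs M ^ (11 * S.d) := by
    rw [pow_mul]
    exact pow_le_pow_left₀ (by have := S.HY_nonneg M hM; positivity) hin _
  calc (S.d : ℝ) * (1 + S.d * (S.HY M * max 1 ‖S.θ‖ ^ (S.A₀ M + S.n M * S.δ₀))) ^ S.d
      ≤ S.Hs M * S.Hs M ^ (11 * S.d) :=
        mul_le_mul (S.d_le_Hs hM) hpow (by have := S.HY_nonneg M hM; positivity) h0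
    _ = S.Hs M ^ (11 * S.d + 1) := by ring

/-- `valB ≤ H^{11d + 10} · e^{-27 K₀ M¹⁴}`. [folklore] -/
lemma valB_le (hM : 1 ≤ M) :
    S.valB M ≤ S.Hs M ^ (11 * S.d + 10) * Real.exp (-(27 * S.K₀ * (M : ℝ) ^ 14)) := by
  unfold valB
  have h0 := (S.Hs_pos M).le
  have h1 := S.bpow_le_Hs hM
  have h2 := S.ξB_le hM
  have h3 := S.cof_le hM
  have hξ0 : 0 ≤ S.ξB M := by
    unfold ξB
    have : 0 ≤ S.Cp M := by unfold Cp; have := S.CfB_nonneg M hM; positivity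
    positivity
  have hcof0 : 0 ≤ (S.d : ℝ) * (1 + S.d * (S.HY M * max 1 ‖S.θ‖ ^ (S.A₀ M + S.n M * S.δ₀))) ^ S.d := by
    have := S.HY_nonneg M hM; positivity
  calc ‖Polynomial.aeval S.θ S.E.b‖ ^ S.n M * S.ξB M *
        ((S.d : ℝ) * (1 + S.d * (S.HY M * max 1 ‖S.θ‖ ^ (S.A₀ M + S.n M * S.δ₀))) ^ S.d)
      ≤ S.Hs M * (S.Hs M ^ 8 * Real.exp (-(27 * S.K₀ * (M : ℝ) ^ 14))) * S.Hs M ^ (11 * S.d + 1) :=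
        mul_le_mul (mul_le_mul h1 h2 hξ0 h0) h3 hcof0 (by positivity)
    _ = S.Hs M ^ (11 * S.d + 10) * Real.exp (-(27 * S.K₀ * (M : ℝ) ^ 14)) := by ring

/-- **Level `M`** (Tubbs §5, p. 127: "`P_N(θ) ≠ 0`, `deg P_N ≪ …`, `log H(P_N) ≪ …`,
`log |P_N(θ)| ≤ -c …`"): for `M ≥ 1` some nonzero `Q ∈ ℤ[T]` has `deg Q ≤ K_deg M⁶`,
`log ‖Q‖₁ ≤ 9 d k_H M⁷` and `log |Q(θ)| ≤ (11d + 10) k_H M⁷ - 27 K₀ M¹⁴`.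
[cite: Tubbs1990, §5 (p. 127)] -/
theorem level (hM : 1 ≤ M) :
    ∃ Q : ℤ[X], Q ≠ 0 ∧ Q.natDegree ≤ S.d * (2 * S.ν * S.δ₀ + 1) * M ^ 6 ∧
      Real.log (zl1 Q) ≤ 9 * S.d * S.kH * (M : ℝ) ^ 7 ∧
      Real.log ‖Polynomial.aeval S.θ Q‖ ≤
        (11 * S.d + 10) * S.kH * (M : ℝ) ^ 7 - 27 * S.K₀ * (M : ℝ) ^ 14 := by
  obtain ⟨Q, hQθ, hdeg, hzl1, hval⟩ := S.level_struct M hM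
  have hQ0 : Q ≠ 0 := fun h => hQθ (by rw [h, map_zero])
  have h0 := (S.Hs_pos M).le
  refine ⟨Q, hQ0, ?_, ?_, ?_⟩
  · refine hdeg.trans ?_
    unfold A₀ n
    have h6 : 1 ≤ M ^ 6 := Nat.one_le_pow _ _ hM
    calc S.d * (S.ν * M ^ 6 * S.δ₀ + 1 + S.ν * M ^ 6 * S.δ₀)
        ≤ S.d * (S.ν * M ^ 6 * S.δ₀ + M ^ 6 + S.ν * M ^ 6 * S.δ₀) := by gcongr
      _ = S.d * (2 * S.ν * S.δ₀ + 1) * M ^ 6 := by ring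
  · have hpos : 0 < zl1 Q := lt_of_lt_of_le zero_lt_one
      ((Polynomial.one_le_supNorm_of_ne_zero hQ0).trans (Chudnovsky.supNorm_le_zl1 Q))
    rw [Real.log_le_iff_le_exp hpos]
    calc zl1 Q ≤ ((S.d : ℝ) * S.HY M) ^ S.d := hzl1
      _ ≤ (S.Hs M ^ (1 + 8)) ^ S.d :=
          pow_le_pow_left₀ (by have := S.HY_nonneg M hM; positivity)
            (mul_le_pow_add h0 (le_pow_one_of_le (S.d_le_Hs hM)) (S.HY_le hM) (S.HY_nonneg M hM)) _
      _ = Real.exp (9 * S.d * S.kH * (M : ℝ) ^ 7) := by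
          rw [← pow_mul, Hs, ← Real.exp_nat_mul]
          congr 1
          push_cast
          ring
  · have hpos : 0 < ‖Polynomial.aeval S.θ Q‖ := norm_pos_iff.mpr hQθ
    rw [Real.log_le_iff_le_exp hpos]
    calc ‖Polynomial.aeval S.θ Q‖ ≤ S.valB M := hval
      _ ≤ S.Hs M ^ (11 * S.d + 10) * Real.exp (-(27 * S.K₀ * (M : ℝ) ^ 14)) := S.valB_le hM
      _ = Real.exp ((11 * S.d + 10) * S.kH * (M : ℝ) ^ 7 - 27 * S.K₀ * (M : ℝ) ^ 14) := by
          rw [Hs, ← Real.exp_nat_mul, ← Real.exp_add]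
          congr 1
          push_cast
          ring

end ExpBounds

/-! ### Gel'fond's criterion: the contradiction -/

section Core

/-- **The core contradiction** (Tubbs §5, p. 127: "we may apply the criterion of Gel'fond … to
conclude that `θ` is algebraic, a contradiction"): a `Setup` cannot exist. Gel'fond's criterion
(`gelfond_criterion_not_small_values`, Baker's Lemma 5 form) is applied to the polynomials `Q_M` of
`level` along `M = N + M₀`, with `δ_N ≍ M⁶`, `σ_N ≍ M⁷`, `a = 128`, against the decay `e^{-27K₀M¹⁴}`.
[cite: Tubbs1990, §5 (p. 127)] -/
theorem core (S : Setup) : False := by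
  classical
  -- constants
  set Kdeg : ℝ := ((S.d * (2 * S.ν * S.δ₀ + 1) : ℕ) : ℝ) with hKdeg
  set Kt : ℝ := 9 * S.d * S.kH with hKt
  set Kv : ℝ := (11 * S.d + 10) * S.kH with hKv
  have hKdeg0 : 0 ≤ Kdeg := Nat.cast_nonneg _
  have hKt0 : 0 ≤ Kt := by rw [hKt]; have := S.kH_nonneg; positivity
  set G : ℝ := 40 * 128 * ((Kdeg + 1) * (Kdeg + Kt + 1)) with hG
  -- threshold and level function
  set M₀ : ℕ := ⌈Kv⌉₊ + ⌈G⌉₊ + 2 with hM₀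
  set mOf : ℕ → ℕ := fun N => N + M₀ with hmOf
  have hmOf1 : ∀ N, 1 ≤ mOf N := fun N => by simp only [hmOf, hM₀]; omega
  have hmR : ∀ N, (2 : ℝ) ≤ (mOf N : ℝ) := fun N => by
    have : 2 ≤ mOf N := by simp only [hmOf, hM₀]; omega
    exact_mod_cast this
  have hmKv : ∀ N, Kv ≤ (mOf N : ℝ) := fun N => by
    have h1 : (⌈Kv⌉₊ : ℝ) ≤ (mOf N : ℝ) := by
      have : ⌈Kv⌉₊ ≤ mOf N := by simp only [hmOf, hM₀]; omega
      exact_mod_cast this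
    exact (Nat.le_ceil Kv).trans h1
  have hmG : ∀ N, G < (mOf N : ℝ) := fun N => by
    have h1 : (⌈G⌉₊ : ℝ) + 1 ≤ (mOf N : ℝ) := by
      have : ⌈G⌉₊ + 1 ≤ mOf N := by simp only [hmOf, hM₀]; omega
      exact_mod_cast this
    linarith [Nat.le_ceil G]
  -- the polynomials
  have hlev : ∀ N, ∃ Q : ℤ[X], Q ≠ 0 ∧ ((Q.natDegree : ℕ) : ℝ) ≤ Kdeg * (mOf N : ℝ) ^ 6 ∧
      Real.log (zl1 Q) ≤ Kt * (mOf N : ℝ) ^ 7 ∧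
      Real.log ‖Polynomial.aeval S.θ Q‖ ≤ Kv * (mOf N : ℝ) ^ 7 - 27 * S.K₀ * (mOf N : ℝ) ^ 14 := by
    intro N
    obtain ⟨Q, h0, h1, h2, h3⟩ := S.level (hmOf1 N)
    refine ⟨Q, h0, ?_, ?_, ?_⟩
    · rw [hKdeg]; exact_mod_cast h1
    · rw [hKt]; exact h2
    · rw [hKv]; exact h3
  choose P hP using hlev
  -- the sequences
  let δ : ℕ → ℝ := fun N => (Kdeg + 1) * (mOf N : ℝ) ^ 6
  let σ : ℕ → ℝ := fun N => (Kdeg + Kt + 1) * (mOf N : ℝ) ^ 7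
  have hsucc : ∀ N, (mOf (N + 1) : ℝ) = mOf N + 1 := fun N => by simp only [hmOf]; push_cast; ring
  have hmono : ∀ {a b : ℕ}, a ≤ b → (mOf a : ℝ) ≤ mOf b := fun h => by
    simp only [hmOf]; exact_mod_cast Nat.add_le_add_right h _
  have hδm : Monotone δ := fun a b h => by
    simp only [δ]
    exact mul_le_mul_of_nonneg_left (pow_le_pow_left₀ (by linarith [hmR a]) (hmono h) 6) (by positivity)
  have hσm : Monotone σ := fun a b h => by
    simp only [σ]
    exact mul_le_mul_of_nonneg_left (pow_le_pow_left₀ (by linarith [hmR a]) (hmono h) 7) (by positivity)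
  have hδ0 : ∀ N, 0 < δ N := fun N => by simp only [δ]; have := hmR N; positivity
  have hσ0 : ∀ N, 0 < σ N := fun N => by simp only [σ]; have := hmR N; positivity
  have hσge : ∀ N : ℕ, (N : ℝ) ≤ σ N := fun N => by
    simp only [σ]
    have h1 : (N : ℝ) ≤ mOf N := by simp only [hmOf]; push_cast; linarith
    have h2 : (mOf N : ℝ) ≤ (mOf N : ℝ) ^ 7 := le_pow_seven (by linarith [hmR N])
    have h3 : (mOf N : ℝ) ^ 7 ≤ (Kdeg + Kt + 1) * (mOf N : ℝ) ^ 7 :=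
      le_mul_of_one_le_left (by positivity) (by linarith)
    linarith
  have hσ : Tendsto σ atTop atTop := tendsto_atTop_mono hσge tendsto_natCast_atTop_atTop
  have hδa : ∀ N, δ (N + 1) ≤ 128 * δ N := fun N => by
    simp only [δ]
    rw [hsucc]
    have hx := hmR N
    have h1 : ((mOf N : ℝ) + 1) ^ 6 ≤ (2 * (mOf N : ℝ)) ^ 6 :=
      pow_le_pow_left₀ (by linarith) (by linarith) 6
    have h2 : (2 * (mOf N : ℝ)) ^ 6 = 64 * (mOf N : ℝ) ^ 6 := by ring
    have h3 : 0 ≤ (mOf N : ℝ) ^ 6 := by positivity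
    nlinarith
  have hσa : ∀ N, σ (N + 1) < 128 * σ N := fun N => by
    simp only [σ]
    rw [hsucc]
    have hx := hmR N
    have h1 : ((mOf N : ℝ) + 1) ^ 7 < (2 * (mOf N : ℝ)) ^ 7 :=
      pow_lt_pow_left₀ (by linarith) (by linarith) (by norm_num)
    have h2 : (2 * (mOf N : ℝ)) ^ 7 = 128 * (mOf N : ℝ) ^ 7 := by ring
    have h3 : 0 < Kdeg + Kt + 1 := by linarith
    nlinarith
  -- the three conditions at each level
  have hPN : ∀ N, 0 ≤ N → P N ≠ 0 ∧ ((P N).natDegree : ℝ) < δ N ∧ (P N).gelfondType < σ N := by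
    intro N _
    obtain ⟨hQ0, hQdeg, hQzl1, -⟩ := hP N
    have hx := hmR N
    have hx6 : 0 < (mOf N : ℝ) ^ 6 := by positivity
    have hx7 : 0 < (mOf N : ℝ) ^ 7 := by positivity
    refine ⟨hQ0, ?_, ?_⟩
    · simp only [δ]; nlinarith
    · unfold Polynomial.gelfondType
      have hsup1 : 1 ≤ (P N).supNorm := Polynomial.one_le_supNorm_of_ne_zero hQ0
      have hlog : Real.log (P N).supNorm ≤ Real.log (zl1 (P N)) :=
        Real.log_le_log (by linarith) (Chudnovsky.supNorm_le_zl1 _)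
      simp only [σ]
      have h67 : (mOf N : ℝ) ^ 6 ≤ (mOf N : ℝ) ^ 7 := pow_le_pow_right₀ (by linarith) (by norm_num)
      have hK67 : Kdeg * (mOf N : ℝ) ^ 6 ≤ Kdeg * (mOf N : ℝ) ^ 7 := mul_le_mul_of_nonneg_left h67 hKdeg0
      nlinarith
  obtain ⟨N, -, hle⟩ := Literature.NumberTheory.Transcendental.gelfond_criterion_not_small_values
    S.hθ 128 (by norm_num) δ σ hδm hσm hδ0 hσ0 hσ hδa hσa P 0 hPN
  -- but `|P_N(θ)| ≤ exp(K_v M⁷ - 27 K₀ M¹⁴) < exp(-40·128·δ_N σ_N)`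
  obtain ⟨hQ0, -, -, hQval⟩ := hP N
  have hQθ : Polynomial.aeval S.θ (P N) ≠ 0 := S.aeval_theta_ne_zero hQ0
  have hpos : 0 < ‖Polynomial.aeval S.θ (P N)‖ := norm_pos_iff.mpr hQθ
  have hval : ‖Polynomial.aeval S.θ (P N)‖ ≤
      Real.exp (Kv * (mOf N : ℝ) ^ 7 - 27 * S.K₀ * (mOf N : ℝ) ^ 14) :=
    (Real.log_le_iff_le_exp hpos).mp hQval
  have hx := hmR N
  have hK1 : (1 : ℝ) ≤ S.K₀ := by exact_mod_cast S.one_le_K₀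
  have hgap : Kv * (mOf N : ℝ) ^ 7 - 27 * S.K₀ * (mOf N : ℝ) ^ 14 < -40 * 128 * δ N * σ N := by
    simp only [δ, σ]
    have h1 : Kv * (mOf N : ℝ) ^ 7 ≤ (mOf N : ℝ) ^ 14 := by
      calc Kv * (mOf N : ℝ) ^ 7 ≤ (mOf N : ℝ) * (mOf N : ℝ) ^ 7 :=
            mul_le_mul_of_nonneg_right (hmKv N) (by positivity)
        _ = (mOf N : ℝ) ^ 8 := by ring
        _ ≤ (mOf N : ℝ) ^ 14 := pow_le_pow_right₀ (by linarith) (by norm_num)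
    have h2 : G * (mOf N : ℝ) ^ 13 < (mOf N : ℝ) ^ 14 := by
      calc G * (mOf N : ℝ) ^ 13 < (mOf N : ℝ) * (mOf N : ℝ) ^ 13 :=
            mul_lt_mul_of_pos_right (hmG N) (by positivity)
        _ = (mOf N : ℝ) ^ 14 := by ring
    have h3 : (2 : ℝ) * (mOf N : ℝ) ^ 14 ≤ 27 * S.K₀ * (mOf N : ℝ) ^ 14 := by
      have : 0 ≤ (mOf N : ℝ) ^ 14 := by positivity
      nlinarith
    have e : -40 * 128 * ((Kdeg + 1) * (mOf N : ℝ) ^ 6) * ((Kdeg + Kt + 1) * (mOf N : ℝ) ^ 7) =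
        -(G * (mOf N : ℝ) ^ 13) := by rw [hG]; ring
    rw [e]
    linarith
  have := lt_of_le_of_lt (hle.trans hval) (Real.exp_lt_exp.mpr hgap)
  exact lt_irrefl _ this

end Core

end Setup

/-! ### The seven generators are algebraic over `ℚ(θ)` -/

/-- Integrality of a root of `X² + s`. [folklore] -/
lemma isIntegral_of_sq_add {R : Type*} [CommRing R] [Algebra R ℂ] (s : R) {x : ℂ}
    (hx : x ^ 2 + algebraMap R ℂ s = 0) : IsIntegral R x := by
  refine ⟨Polynomial.X ^ 2 + Polynomial.C s, Polynomial.monic_X_pow_add_C s two_ne_zero, ?_⟩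
  simp [hx]

/-- Integrality of a root of `X³ + s X + t`. [folklore] -/
lemma isIntegral_of_cubic {R : Type*} [CommRing R] [Algebra R ℂ] (s t : R) {x : ℂ}
    (hx : x ^ 3 + algebraMap R ℂ s * x + algebraMap R ℂ t = 0) : IsIntegral R x := by
  refine ⟨Polynomial.X ^ 3 + (Polynomial.C s * Polynomial.X + Polynomial.C t), ?_, ?_⟩
  · refine Polynomial.monic_X_pow_add ?_
    have h1 : (Polynomial.C s * Polynomial.X + Polynomial.C t : Polynomial R).degree ≤ 1 := by
      refine (Polynomial.degree_add_le _ _).trans (max_le (Polynomial.degree_C_mul_X_le s) ?_)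
      exact (Polynomial.degree_C_le (a := t)).trans (by norm_num)
    exact h1.trans_lt (by norm_num)
  · simp only [Polynomial.eval₂_add, Polynomial.eval₂_pow, Polynomial.eval₂_X, Polynomial.eval₂_mul,
      Polynomial.eval₂_C]
    rw [← hx]; ring

/-- **From "`g₂, g₃, ω₁, ω₂, c, e^{cω₁}, e^{cω₂}` algebraic over `K₀`" to "`x` algebraic over `K₀`"**
for the seven generators `x = (ω₁/2, ω₂, c, e^{cω₁/2}, e^{cω₂}, e₁, g₂/2)` of the value polynomials
(`(e^{cω₁/2})² = e^{cω₁}`, `4e₁³ - g₂e₁ - g₃ = 0`). [cite: Tubbs1990, §5 (p. 124)] -/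
theorem isAlgebraic_xv (L : PeriodPair) (c : ℂ) (K₀ : IntermediateField ℚ ℂ)
    (h : ∀ s ∈ ({L.g₂, L.g₃, L.ω₁, L.ω₂, c, cexp (c * L.ω₁), cexp (c * L.ω₂)} : Set ℂ),
      IsAlgebraic K₀ s) :
    ∀ l, IsAlgebraic K₀ (xv L c l) := by
  obtain ⟨S, hS⟩ : ∃ S : Subalgebra K₀ ℂ, S = integralClosure K₀ ℂ := ⟨_, rfl⟩
  have hmem : ∀ {y : ℂ}, IsAlgebraic K₀ y → y ∈ S := fun hy => by
    rw [hS]; exact hy.isIntegral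
  have hmem' : ∀ {y : ℂ}, y ∈ S → IsIntegral K₀ y := fun hy => by
    rw [hS] at hy; exact hy
  haveI : Algebra.IsIntegral K₀ S := by rw [hS]; infer_instance
  have hg₂ : L.g₂ ∈ S := hmem (h _ (by simp))
  have hg₃ : L.g₃ ∈ S := hmem (h _ (by simp))
  have hω₁ : L.ω₁ ∈ S := hmem (h _ (by simp))
  have hω₂ : L.ω₂ ∈ S := hmem (h _ (by simp))
  have hc : c ∈ S := hmem (h _ (by simp))
  have he1 : cexp (c * L.ω₁) ∈ S := hmem (h _ (by simp))
  have he2 : cexp (c * L.ω₂) ∈ S := hmem (h _ (by simp))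
  have hK : ∀ q : ℚ, ((q : ℂ)) ∈ S := fun q => by
    simpa using S.algebraMap_mem (algebraMap ℚ K₀ q)
  have halg : ∀ {y : ℂ}, IsIntegral S y → IsAlgebraic K₀ y := fun hy =>
    (isIntegral_trans (R := K₀) _ hy).isAlgebraic
  have halfmem : ∀ {y : ℂ}, y ∈ S → y / 2 ∈ S := fun hy => by
    rw [div_eq_mul_inv]; exact S.mul_mem hy (by simpa using hK (1 / 2))
  intro l
  fin_cases l
  · show IsAlgebraic K₀ (L.ω₁ / 2)
    exact (hmem' (halfmem hω₁)).isAlgebraic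
  · show IsAlgebraic K₀ L.ω₂
    exact (hmem' hω₂).isAlgebraic
  · show IsAlgebraic K₀ c
    exact (hmem' hc).isAlgebraic
  · -- `e^{cω₁/2}`, with `(e^{cω₁/2})² = e^{cω₁}`
    show IsAlgebraic K₀ (cexp (c * (L.ω₁ / 2)))
    have hs : -cexp (c * L.ω₁) ∈ S := S.neg_mem he1
    refine halg (isIntegral_of_sq_add (⟨_, hs⟩ : S) ?_)
    change cexp (c * (L.ω₁ / 2)) ^ 2 + -cexp (c * L.ω₁) = 0
    have e : c * (L.ω₁ / 2) + c * (L.ω₁ / 2) = c * L.ω₁ := by ring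
    rw [sq, ← Complex.exp_add, e]
    ring
  · show IsAlgebraic K₀ (cexp (c * L.ω₂))
    exact (hmem' he2).isAlgebraic
  · -- `e₁`, with `4 e₁³ - g₂ e₁ - g₃ = 0`
    show IsAlgebraic K₀ (e₁ L)
    have hs : -(L.g₂ / 4) ∈ S := S.neg_mem (by
      rw [div_eq_mul_inv]; exact S.mul_mem hg₂ (by simpa using hK (1 / 4)))
    have ht : -(L.g₃ / 4) ∈ S := S.neg_mem (by
      rw [div_eq_mul_inv]; exact S.mul_mem hg₃ (by simpa using hK (1 / 4)))
    refine halg (isIntegral_of_cubic (⟨_, hs⟩ : S) (⟨_, ht⟩ : S) ?_)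
    have := Chudnovsky.e₁_cubic L
    change e₁ L ^ 3 + -(L.g₂ / 4) * e₁ L + -(L.g₃ / 4) = 0
    linear_combination this / 4
  · show IsAlgebraic K₀ (L.g₂ / 2)
    exact (hmem' (halfmem hg₂)).isAlgebraic

/-! ### The theorem -/

/-- **Tubbs 1990, Theorem 4 (periods form)** — proved along the printed architecture: for a lattice
basis `(ω₁, ω₂)` and `c ≠ 0`, two of `g₂, g₃, ω₁, ω₂, c, e^{cω₁}, e^{cω₂}` are algebraically
independent over `ℚ`. WLOG `|e^{cω₂}| ≠ 1` (`Tubbs1990_thm4_periods_of_norm_exp_ne_one`); if the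
transcendence degree were `< 2`, all seven numbers would be algebraic over `ℚ(θ)` for a
transcendental `θ` (`exists_theta_of_not_two_le_trdeg`), hence so would be the seven generators of
the value polynomials (`Tubbs.isAlgebraic_xv`), giving an envelope
(`BrownawellWaldschmidt.exists_envelope`) and a `Tubbs.Setup`, which is contradictory
(`Tubbs.Setup.core`).

The fact's discharge of record is the root-namespace theorem
`Literature.NumberTheory.Transcendental.Tubbs1990_thm4_periods_holds` (`TubbsPeriodsMain.lean`,
landed in parallel; it replaces the zero estimate by extrapolation plus Tijdeman's lemma). The
present theorem proves the same statement through the multiplicity estimate on `𝔾ₘ × E × 𝔾ₐ`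
(`TubbsPeriodsIndependenceZeroEst.lean`), i.e. through steps (13)–(18) of Tubbs §5 as printed.
[cite: Tubbs1990, Thm 4 (p. 112), §5 (pp. 124–127)] -/
theorem Tubbs1990_thm4_periods_holds : Tubbs1990_thm4_periods := by
  refine Tubbs1990_thm4_periods_of_norm_exp_ne_one fun L c hc hB => ?_
  by_contra hlt
  obtain ⟨θ, hθ, halg⟩ := exists_theta_of_not_two_le_trdeg _ hlt
  obtain ⟨E⟩ := BrownawellWaldschmidt.exists_envelope θ (xv L c) (isAlgebraic_xv L c ℚ⟮θ⟯ halg)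
  exact Setup.core ⟨L, c, hc, hB, θ, hθ, E⟩

end Tubbs

end Literature.NumberTheory.Transcendental
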